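import Literature.NumberTheory.LFunctions.MontgomeryPairCorrelationProofs
import Literature.NumberTheory.LFunctions.MontgomeryCauchyKernel
import Literature.NumberTheory.LFunctions.MontgomeryZeroWindows
import Mathlib.Analysis.SpecialFunctions.JapaneseBracket
import HarnessLib

/-!
# Montgomery's pair sum as a mean square: discharge of (P2) `montgomery_pairSum_eq_meanSquare`

Trunk T-ANT (`Literature/NumberTheory/LFunctions`). Proofs only (no definitions, no named facts).
This file DISCHARGES the named fact (P2) of `MontgomeryPairCorrelation.lean`,

* `Literature.NumberTheory.LFunctions.montgomery_pairSum_eq_meanSquare_holds :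
  montgomery_pairSum_eq_meanSquare`,

i.e. Goldston 2005, (4.3) (Montgomery 1973, §3): there is an absolute `C` with
`|F(x,T) − (2/π) ∫_0^T |∑_γ x^{iγ}/(1+(t−γ)²)|² dt| ≤ C log³ T` for all `x > 0`, `T ≥ 2`, where
`F(x,T) = ∑_{0<γ,γ'≤T} x^{i(γ−γ')} w(γ−γ')` (`montgomeryPairSum`) and the sum over `γ` runs over all
ordinates with multiplicity (`montgomeryZeroSum`). It is one of the three inputs of the accepted
assembly `montgomery_pair_correlation_restricted_of_facts` (`MontgomeryPairCorrelationProofs.lean`)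
of Montgomery's pair correlation theorem `montgomery_pair_correlation_restricted`.

## The argument (Goldston 2005, §4, (4.1)–(4.4); Montgomery 1973, §3)

Write `S(t) = ∑_γ x^{iγ}/(1+(t−γ)²)` (all ordinates, both signs) and `S₁(t)` for its part over
`0 < γ ≤ T`, i.e. over the indices `n < N(T)` of the tree's enumeration `γ_n = zetaOrdinate n`.

1. **Local density of zeros.** `N(a+1) − N(a) ≤ A log(a+2)` for all `a ≥ 0`
   (`Montgomery.exists_zetaZeroCount_add_one_sub_le`), from the Riemann–von Mangoldt formula
   `riemann_von_mangoldt_holds` (`ZetaArgVariation.lean`) for large `a` and the boundedness of `N`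
   below. Sums `∑_n g(γ_n)` are then dominated window by window
   (`Montgomery.sum_le_sum_windows_log`), using the dictionary `γ_n ≤ T ↔ n < N(T)`
   (`Montgomery.zetaOrdinate_le_iff_lt`, `MontgomeryZeroWindows.lean`, from
   `riemann_von_mangoldt.zetaOrdinate_le_iff`).
2. **`D(t) = ∑_γ 1/(1+(t−γ)²) ≪ log(|t|+2)`** (`Montgomery.exists_density_le`; Goldston (2.18)),
   and the four window sums (Za)–(Zd) `∑_{γ>T}(arctan γ − arctan(γ−T))`,
   `∑_γ (arctan(T+γ) − arctan γ)`, `∑_{γ≤T}(π/2 − arctan(T−γ))`, `∑_{γ≤T}(π/2 − arctan γ)`, all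
   `≪ log²(T+2)` (near windows: harmonic sums; far windows: `∑_{m≥M} log(m+2)/m² ≪ log M/M` by
   telescoping).
3. **`∫_0^T |S|² = ∫_0^T |S₁|² + O(log³ T)`**: pointwise `||S|² − |S₁|²| ≤ 3 D(t) R(t)` with
   `R(t) = ∑_{γ>T} 1/(1+(t−γ)²) + ∑_γ 1/(1+(t+γ)²) ≥ |S − S₁|`
   (`Montgomery.abs_norm_sq_sub_norm_sq_le`), and `∫_0^T R ≪ log² T` by termwise integration
   (dominated convergence) and (Za), (Zb) (`Montgomery.exists_integral_tailSum_le`).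
4. **`∫_{ℝ∖[0,T]} |S₁|² ≪ log³ T`** (`Montgomery.exists_integral_Ioi_norm_partial_sq_le`,
   `Montgomery.exists_integral_Iic_norm_partial_sq_le`): off `[0, T]` the Cauchy weights are
   monotone, so `|S₁(t)| ≤ D(T)` resp. `D(0)`, and the remaining integrals are (Zc), (Zd).
5. **`∫_ℝ |S₁|² = (π/2) F(x,T)`** exactly (`Montgomery.integral_norm_partial_sq`): multiply out and
   use `∫_ℝ dt/((1+(t−γ)²)(1+(t−γ')²)) = 2π/(4+(γ−γ')²) = (π/2) w(γ−γ')`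
   (`Montgomery.integral_cauchyKernel_mul_cauchyKernel`, `MontgomeryCauchyKernel.lean`).

Everything here is proved; the constants are absolute and not computed.

## References

* H. L. Montgomery, *The pair correlation of zeros of the zeta function*, Analytic Number Theory
  (St. Louis 1972), Proc. Sympos. Pure Math. 24, AMS (1973), 181–193, §3.
* D. A. Goldston, *Notes on pair correlation of zeros and prime numbers*, in: Recent Perspectives
  in Random Matrix Theory and Number Theory, LMS Lecture Note Ser. 322, CUP (2005), 79–110
  (arXiv:math/0412313), (2.18), §4 (4.1)–(4.4).
* E. C. Titchmarsh, *The Theory of the Riemann Zeta-Function*, 2nd ed. (rev. D. R. Heath-Brown),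
  OUP 1986, §9.1, Thms. 9.2, 9.4.
-/

noncomputable section

open Complex Filter Set MeasureTheory intervalIntegral
open scoped Real Topology

namespace Literature.NumberTheory.LFunctions

namespace Montgomery

/-! ## Local density of the zeros from the Riemann–von Mangoldt formula -/

/-- The main term `M(u) = (u/2π) log(u/2π) − u/2π` of the Riemann–von Mangoldt formula increases
by at most `log(a+2)` on `[a, a+1]` (`a ≥ 1`): `M(a+1) − M(a) = (a log(1+1/a) + log((a+1)/2π) − 1)/2π
≤ log(a+1)/2π`. [folklore] -/
theorem rvmMain_add_one_sub_le {a : ℝ} (ha : 1 ≤ a) :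
    ((a + 1) / (2 * π) * Real.log ((a + 1) / (2 * π)) - (a + 1) / (2 * π)) -
        (a / (2 * π) * Real.log (a / (2 * π)) - a / (2 * π)) ≤ Real.log (a + 2) := by
  have hπ : 0 < 2 * π := by positivity
  have ha0 : 0 < a := by linarith
  have hL : 0 < Real.log (2 * π) := Real.log_pos (by linarith [Real.pi_gt_three])
  rw [Real.log_div (by linarith) hπ.ne', Real.log_div ha0.ne' hπ.ne']
  have h1 : a * (Real.log (a + 1) - Real.log a) ≤ 1 := by
    rw [← Real.log_div (by linarith) ha0.ne']
    have : Real.log ((a + 1) / a) ≤ (a + 1) / a - 1 := Real.log_le_sub_one_of_pos (by positivity)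
    have e : (a + 1) / a - 1 = 1 / a := by field_simp; ring
    rw [e] at this
    calc a * Real.log ((a + 1) / a) ≤ a * (1 / a) := mul_le_mul_of_nonneg_left this ha0.le
      _ = 1 := by field_simp
  have h2 : Real.log (a + 1) ≤ Real.log (a + 2) := Real.log_le_log (by linarith) (by linarith)
  have h3 : 0 ≤ Real.log (a + 1) := Real.log_nonneg (by linarith)
  have hπ3 := Real.pi_gt_three
  -- the difference equals `(a (log(a+1) − log a) + log(a+1) − log 2π − 1)/(2π)`
  have e : ((a + 1) / (2 * π) * (Real.log (a + 1) - Real.log (2 * π)) - (a + 1) / (2 * π)) -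
      (a / (2 * π) * (Real.log a - Real.log (2 * π)) - a / (2 * π)) =
      (a * (Real.log (a + 1) - Real.log a) + Real.log (a + 1) - Real.log (2 * π) - 1) / (2 * π) := by
    field_simp
    ring
  rw [e, div_le_iff₀ hπ]
  nlinarith

/-- **Local density of the zeros** (Titchmarsh Thm. 9.2; Montgomery–Vaughan Thm. 10.13):
there is `A > 0` with `N(a + 1) − N(a) ≤ A log(a + 2)` for every `a ≥ 0`; from the
Riemann–von Mangoldt formula `riemann_von_mangoldt_holds` for large `a`, and from the
boundedness of `N` on an initial segment. [cite: Titchmarsh1986, Thm. 9.2] -/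
theorem exists_zetaZeroCount_add_one_sub_le :
    ∃ A : ℝ, 0 < A ∧ ∀ a : ℝ, 0 ≤ a →
      (zetaZeroCount (a + 1) : ℝ) - zetaZeroCount a ≤ A * Real.log (a + 2) := by
  have h := riemann_von_mangoldt_holds
  obtain ⟨C₀, hC₀, hbd⟩ := h.exists_pos
  obtain ⟨T₀, hT₀⟩ := eventually_atTop.1 (hbd.bound.and (eventually_ge_atTop (1 : ℝ)))
  set K : ℝ := (zetaZeroCount (T₀ + 1) : ℝ) with hK
  have hK0 : 0 ≤ K := Nat.cast_nonneg _
  have hlog2 : (1 : ℝ) / 2 < Real.log 2 := by linarith [Real.log_two_gt_d9]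
  refine ⟨2 * C₀ + 1 + K / Real.log 2, by positivity, fun a ha ↦ ?_⟩
  have hla : Real.log 2 ≤ Real.log (a + 2) := Real.log_le_log two_pos (by linarith)
  have hla0 : 0 ≤ Real.log (a + 2) := le_trans (Real.log_nonneg one_le_two) hla
  by_cases hA : T₀ ≤ a
  · -- large `a`: Riemann–von Mangoldt at `a` and at `a + 1`
    obtain ⟨hb1, ha1⟩ := hT₀ a hA
    obtain ⟨hb2, -⟩ := hT₀ (a + 1) (by linarith)
    rw [Real.norm_eq_abs, Real.norm_of_nonneg (Real.log_nonneg ha1)] at hb1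
    rw [Real.norm_eq_abs, Real.norm_of_nonneg (Real.log_nonneg (by linarith))] at hb2
    have hm := rvmMain_add_one_sub_le ha1
    have hl1 : Real.log a ≤ Real.log (a + 2) := Real.log_le_log (by linarith) (by linarith)
    have hl2 : Real.log (a + 1) ≤ Real.log (a + 2) := Real.log_le_log (by linarith) (by linarith)
    have := abs_le.1 hb1
    have := abs_le.1 hb2
    have hKn : 0 ≤ K / Real.log 2 * Real.log (a + 2) := by positivity
    nlinarith
  · -- small `a`: `N(a+1) − N(a) ≤ N(T₀ + 1) = K ≤ (K/log 2) log(a+2)`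
    push Not at hA
    have h1 : (zetaZeroCount (a + 1) : ℝ) ≤ K :=
      Nat.cast_le.2 (zetaZeroCount_mono (by linarith))
    have h2 : (0 : ℝ) ≤ zetaZeroCount a := Nat.cast_nonneg _
    have h3 : K ≤ K / Real.log 2 * Real.log (a + 2) := by
      rw [div_mul_eq_mul_div, le_div_iff₀ (by linarith)]
      exact mul_le_mul_of_nonneg_left hla hK0
    have h4 : 0 ≤ (2 * C₀ + 1) * Real.log (a + 2) := by positivity
    nlinarith

/-! ## The enumeration `γ_n` against the counting function -/

/-- The indices `n` with `a < γ_n ≤ b` lie in `[N(a), N(b))`; hence there are at most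
`N(b) − N(a)` of them in any finite set (`a ≤ b`). [cite: Titchmarsh1986, §9.1] -/
theorem card_filter_Ioc_le (S : Finset ℕ) {a b : ℝ} (hab : a ≤ b) :
    ((S.filter fun n ↦ a < zetaOrdinate n ∧ zetaOrdinate n ≤ b).card : ℝ) ≤
      (zetaZeroCount b : ℝ) - zetaZeroCount a := by
  have hsub : (S.filter fun n ↦ a < zetaOrdinate n ∧ zetaOrdinate n ≤ b) ⊆
      Finset.Ico (zetaZeroCount a) (zetaZeroCount b) := by
    intro n hn
    rw [Finset.mem_filter] at hn
    rw [Finset.mem_Ico]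
    refine ⟨?_, zetaOrdinate_le_iff_lt.1 hn.2.2⟩
    by_contra hlt
    exact absurd (zetaOrdinate_le_iff_lt.2 (not_le.1 hlt)) (not_le.2 hn.2.1)
  have hmono : zetaZeroCount a ≤ zetaZeroCount b := zetaZeroCount_mono hab
  calc ((S.filter fun n ↦ a < zetaOrdinate n ∧ zetaOrdinate n ≤ b).card : ℝ)
      ≤ ((Finset.Ico (zetaZeroCount a) (zetaZeroCount b)).card : ℝ) := by
        exact_mod_cast Finset.card_le_card hsub
    _ = (zetaZeroCount b : ℝ) - zetaZeroCount a := by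
        rw [Nat.card_Ico, Nat.cast_sub hmono]

/-- The window index `m = ⌈γ_n⌉ − 1` of the `n`-th ordinate: `m < γ_n ≤ m + 1` (`γ_n > 0`). [folklore] -/
theorem window_spec (n : ℕ) :
    ((⌈zetaOrdinate n⌉₊ - 1 : ℕ) : ℝ) < zetaOrdinate n ∧
      zetaOrdinate n ≤ ((⌈zetaOrdinate n⌉₊ - 1 : ℕ) : ℝ) + 1 := by
  have hpos : 0 < zetaOrdinate n := zetaOrdinate_pos_holds n
  have h1 : 1 ≤ ⌈zetaOrdinate n⌉₊ := Nat.one_le_iff_ne_zero.2 (Nat.ceil_pos.2 hpos).ne'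
  constructor
  · exact Nat.lt_ceil.1 (by omega)
  · have : ((⌈zetaOrdinate n⌉₊ - 1 : ℕ) : ℝ) + 1 = (⌈zetaOrdinate n⌉₊ : ℝ) := by
      rw [Nat.cast_sub h1]; push_cast; ring
    rw [this]
    exact Nat.le_ceil _

/-- **Window domination.** A sum of `g n` over finitely many indices `n` is at most
`∑_m (N(m+1) − N(m)) G_m`, summed over any finite set `W` of windows containing the windows
`m = ⌈γ_n⌉ − 1` of the indices involved, as soon as `g n ≤ G_m` for `n` in window `m` and
`G ≥ 0` on `W`. [folklore] -/
theorem sum_le_sum_windows (S W : Finset ℕ) (hW : ∀ n ∈ S, ⌈zetaOrdinate n⌉₊ - 1 ∈ W)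
    (g : ℕ → ℝ) (G : ℕ → ℝ) (hG : ∀ m ∈ W, 0 ≤ G m)
    (hgG : ∀ n ∈ S, g n ≤ G (⌈zetaOrdinate n⌉₊ - 1)) :
    ∑ n ∈ S, g n ≤ ∑ m ∈ W, ((zetaZeroCount ((m : ℝ) + 1) : ℝ) - zetaZeroCount (m : ℝ)) * G m := by
  rw [← Finset.sum_fiberwise_of_maps_to hW]
  refine Finset.sum_le_sum fun m hm ↦ ?_
  have hcard : (((S.filter fun n ↦ ⌈zetaOrdinate n⌉₊ - 1 = m)).card : ℝ) ≤
      (zetaZeroCount ((m : ℝ) + 1) : ℝ) - zetaZeroCount (m : ℝ) := by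
    refine le_trans (Nat.cast_le.2 <| Finset.card_le_card fun n hn ↦ ?_)
      (card_filter_Ioc_le S (by linarith : (m : ℝ) ≤ (m : ℝ) + 1))
    rw [Finset.mem_filter] at hn ⊢
    have hw := window_spec n
    rw [hn.2] at hw
    exact ⟨hn.1, hw⟩
  calc ∑ n ∈ S with ⌈zetaOrdinate n⌉₊ - 1 = m, g n
      ≤ ∑ n ∈ S with ⌈zetaOrdinate n⌉₊ - 1 = m, G m := by
        refine Finset.sum_le_sum fun n hn ↦ ?_
        rw [Finset.mem_filter] at hn
        have := hgG n hn.1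
        rwa [hn.2] at this
    _ = ((S.filter fun n ↦ ⌈zetaOrdinate n⌉₊ - 1 = m).card : ℝ) * G m := by
        rw [Finset.sum_const, nsmul_eq_mul]
    _ ≤ _ := mul_le_mul_of_nonneg_right hcard (hG m hm)

/-- Window domination combined with the local density bound: `∑_n g n ≤ ∑_m A log(m+2) G_m`. [folklore] -/
theorem sum_le_sum_windows_log {A : ℝ}
    (hA : ∀ a : ℝ, 0 ≤ a → (zetaZeroCount (a + 1) : ℝ) - zetaZeroCount a ≤ A * Real.log (a + 2))
    (S W : Finset ℕ) (hW : ∀ n ∈ S, ⌈zetaOrdinate n⌉₊ - 1 ∈ W)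
    (g : ℕ → ℝ) (G : ℕ → ℝ) (hG : ∀ m ∈ W, 0 ≤ G m)
    (hgG : ∀ n ∈ S, g n ≤ G (⌈zetaOrdinate n⌉₊ - 1)) :
    ∑ n ∈ S, g n ≤ ∑ m ∈ W, A * Real.log ((m : ℝ) + 2) * G m := by
  refine (sum_le_sum_windows S W hW g G hG hgG).trans (Finset.sum_le_sum fun m hm ↦ ?_)
  exact mul_le_mul_of_nonneg_right (hA m (Nat.cast_nonneg m)) (hG m hm)

/-! ## Comparing a sum over windows with an integral -/

/-- Unit cells `(m, m+1]` with distinct natural `m` are disjoint. [folklore] -/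
theorem pairwiseDisjoint_cells (W : Finset ℕ) :
    Set.Pairwise (↑W : Set ℕ) (Function.onFun Disjoint fun m : ℕ ↦ Ioc (m : ℝ) ((m : ℝ) + 1)) := by
  intro m _ m' _ hne
  change Disjoint (Ioc (m : ℝ) ((m : ℝ) + 1)) (Ioc (m' : ℝ) ((m' : ℝ) + 1))
  rw [Set.disjoint_left]
  rintro u ⟨h1, h2⟩ ⟨h3, h4⟩
  rcases lt_or_gt_of_ne hne with h | h
  · have : (m : ℝ) + 1 ≤ m' := by exact_mod_cast h
    linarith
  · have : (m' : ℝ) + 1 ≤ m := by exact_mod_cast h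
    linarith

/-- **Cell comparison.** If `c_m ≤ f(u)` for all `u` in the cell `(m, m+1]`, the cells of `W`
lie in `E`, and `f ≥ 0` is integrable on `E`, then `∑_{m ∈ W} c_m ≤ ∫_E f`. [folklore] -/
theorem sum_le_setIntegral_of_le_on_cells (W : Finset ℕ) (c : ℕ → ℝ) {f : ℝ → ℝ} {E : Set ℝ}
    (hEm : MeasurableSet E) (hE : ∀ m ∈ W, Ioc (m : ℝ) ((m : ℝ) + 1) ⊆ E) (hf : IntegrableOn f E)
    (hf0 : ∀ u ∈ E, 0 ≤ f u)
    (hcf : ∀ m ∈ W, ∀ u : ℝ, (m : ℝ) < u → u ≤ m + 1 → c m ≤ f u) :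
    ∑ m ∈ W, c m ≤ ∫ u in E, f u := by
  have hcell : ∀ m ∈ W, c m ≤ ∫ u in Ioc (m : ℝ) ((m : ℝ) + 1), f u := by
    intro m hm
    have hfi : IntegrableOn f (Ioc (m : ℝ) ((m : ℝ) + 1)) := hf.mono_set (hE m hm)
    calc c m = ∫ _ in Ioc (m : ℝ) ((m : ℝ) + 1), c m := by
          rw [setIntegral_const, Real.volume_real_Ioc_of_le (by linarith)]; simp
      _ ≤ ∫ u in Ioc (m : ℝ) ((m : ℝ) + 1), f u :=
          setIntegral_mono_on (integrableOn_const (by simp)) hfi measurableSet_Ioc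
            fun u hu ↦ hcf m hm u hu.1 hu.2
  calc ∑ m ∈ W, c m ≤ ∑ m ∈ W, ∫ u in Ioc (m : ℝ) ((m : ℝ) + 1), f u := Finset.sum_le_sum hcell
    _ = ∫ u in ⋃ m ∈ W, Ioc (m : ℝ) ((m : ℝ) + 1), f u :=
        (integral_biUnion_finset W (fun _ _ ↦ measurableSet_Ioc) (pairwiseDisjoint_cells W)
          fun m hm ↦ hf.mono_set (hE m hm)).symm
    _ ≤ ∫ u in E, f u :=
        setIntegral_mono_set hf ((ae_restrict_iff' hEm).2 (ae_of_all _ hf0))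
          (Set.iUnion₂_subset hE).eventuallyLE


/-! ## The density `D(t) = ∑_n 1/(1+(t−γ_n)²)` is `≪ log(|t|+2)` -/

/-- Pointwise window bound: for `m < u ≤ m + 1`, `1/(1+(t−u)²) ≤ 8/(4+(t−m)²)`. [folklore] -/
theorem one_div_one_add_sq_le_window {t u m : ℝ} (h1 : m < u) (h2 : u ≤ m + 1) :
    1 / (1 + (t - u) ^ 2) ≤ 8 / (4 + (t - m) ^ 2) := by
  rw [div_le_div_iff₀ (by positivity) (by positivity)]
  have hθ0 : 0 < u - m := sub_pos.2 h1
  have hθ1 : u - m ≤ 1 := by linarith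
  have hθ2 : (u - m) ^ 2 ≤ 1 := by nlinarith
  nlinarith [sq_nonneg (7 * (t - m) - 8 * (u - m))]

/-- `log(m+2) ≤ log(|t|+2) + log(1+|m−t|)` for `m ≥ 0` (`m + 2 ≤ (|t|+2)(1+|m−t|)`). [folklore] -/
theorem log_add_two_le (t : ℝ) {m : ℝ} (hm : 0 ≤ m) :
    Real.log (m + 2) ≤ Real.log (|t| + 2) + Real.log (1 + |m - t|) := by
  rw [← Real.log_mul (by positivity) (by positivity)]
  refine Real.log_le_log (by linarith) ?_
  have h1 : m ≤ |t| + |m - t| := by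
    have := abs_sub_abs_le_abs_sub m t
    rw [abs_of_nonneg hm] at this
    linarith
  nlinarith [abs_nonneg t, abs_nonneg (m - t)]

/-- `log(m+2) ≤ 9 log(|t|+2) (1+|m−t|)^{1/4}` for `m ≥ 0` (`log y ≤ 4 y^{1/4}`, `2 log 2 ≥ 1`). [folklore] -/
theorem log_add_two_le' (t : ℝ) {m : ℝ} (hm : 0 ≤ m) :
    Real.log (m + 2) ≤ 9 * Real.log (|t| + 2) * (1 + |m - t|) ^ (1 / 4 : ℝ) := by
  have hL : 1 / 2 ≤ Real.log (|t| + 2) := by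
    have h2 : (1 : ℝ) / 2 < Real.log 2 := by linarith [Real.log_two_gt_d9]
    exact h2.le.trans (Real.log_le_log two_pos (by linarith [abs_nonneg t]))
  have hy : 1 ≤ 1 + |m - t| := by linarith [abs_nonneg (m - t)]
  have hr1 : 1 ≤ (1 + |m - t|) ^ (1 / 4 : ℝ) := Real.one_le_rpow hy (by norm_num)
  have hlog : Real.log (1 + |m - t|) ≤ 4 * (1 + |m - t|) ^ (1 / 4 : ℝ) := by
    have h := Real.log_le_rpow_div (by linarith : (0 : ℝ) ≤ 1 + |m - t|) (by norm_num : (0 : ℝ) < 1 / 4)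
    have e : (1 + |m - t|) ^ (1 / 4 : ℝ) / (1 / 4) = 4 * (1 + |m - t|) ^ (1 / 4 : ℝ) := by ring
    linarith
  have h0 := log_add_two_le t hm
  nlinarith

/-- `8/(4+s²) ≤ 16/(1+|s|)²`. [folklore] -/
theorem eight_div_le (s : ℝ) : 8 / (4 + s ^ 2) ≤ 16 / (1 + |s|) ^ 2 := by
  rw [div_le_div_iff₀ (by positivity) (by positivity)]
  have : |s| ^ 2 = s ^ 2 := sq_abs s
  nlinarith [abs_nonneg s, sq_nonneg (|s| - 1)]

/-- **`D(t) = ∑_n 1/(1+(t−γ_n)²) ≪ log(|t|+2)`** (Montgomery–Vaughan Lemma 12.1 style consequence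
of `N(T+1) − N(T) ≪ log T`; Goldston 2005, (2.18)): there is `A₁ > 0` with
`∑_n 1/(1+(t−γ_n)²) ≤ A₁ log(|t|+2)` for every real `t` (the series converging). Windows
`(m, m+1]` carry `≪ log(m+2)` ordinates and weight `≤ 8/(4+(t−m)²)`; then
`log(m+2) ≪ log(|t|+2)(1+|m−t|)^{1/4}` and `∑_m (1+|m−t|)^{-7/4} ≤ 2^{7/4}∫(1+|v|)^{-7/4} dv`.
[cite: Goldston2005, (2.18)] -/
theorem exists_density_le :
    ∃ A₁ : ℝ, 0 < A₁ ∧ ∀ t : ℝ,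
      (Summable fun n : ℕ ↦ 1 / (1 + (t - zetaOrdinate n) ^ 2)) ∧
      ∑' n : ℕ, 1 / (1 + (t - zetaOrdinate n) ^ 2) ≤ A₁ * Real.log (|t| + 2) := by
  obtain ⟨A, hA0, hA⟩ := exists_zetaZeroCount_add_one_sub_le
  set J : ℝ := ∫ v : ℝ, (1 + ‖v‖) ^ (-(7 / 4 : ℝ)) with hJ
  have hJint : Integrable fun v : ℝ ↦ (1 + ‖v‖) ^ (-(7 / 4 : ℝ)) :=
    integrable_one_add_norm (by rw [Module.finrank_self]; norm_num)
  have hJ0 : 0 ≤ J := integral_nonneg fun v ↦ by positivity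
  have key : ∀ t : ℝ, ∀ S : Finset ℕ, ∑ n ∈ S, 1 / (1 + (t - zetaOrdinate n) ^ 2) ≤
      144 * A * (2 ^ (7 / 4 : ℝ) * J) * Real.log (|t| + 2) := by
    intro t S
    have hlog0 : 0 ≤ Real.log (|t| + 2) := Real.log_nonneg (by linarith [abs_nonneg t])
    set W : Finset ℕ := S.image fun n ↦ ⌈zetaOrdinate n⌉₊ - 1 with hWdef
    have hW : ∀ n ∈ S, ⌈zetaOrdinate n⌉₊ - 1 ∈ W := fun n hn ↦ Finset.mem_image_of_mem _ hn
    have step1 := sum_le_sum_windows_log hA S W hW (fun n ↦ 1 / (1 + (t - zetaOrdinate n) ^ 2))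
      (fun m ↦ 8 / (4 + (t - m) ^ 2)) (fun m _ ↦ by positivity) fun n _ ↦
        one_div_one_add_sq_le_window (window_spec n).1 (window_spec n).2
    have step2 : ∀ m ∈ W, A * Real.log ((m : ℝ) + 2) * (8 / (4 + (t - m) ^ 2)) ≤
        144 * A * Real.log (|t| + 2) * (1 + |(m : ℝ) - t|) ^ (-(7 / 4 : ℝ)) := by
      intro m _
      have hm0 : (0 : ℝ) ≤ m := Nat.cast_nonneg m
      have h1 := log_add_two_le' t hm0
      have h2 := eight_div_le (t - m)
      rw [abs_sub_comm] at h2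
      have hb : 0 < 1 + |(m : ℝ) - t| := by positivity
      have hr0 : 0 ≤ (1 + |(m : ℝ) - t|) ^ (1 / 4 : ℝ) := by positivity
      have e : (1 + |(m : ℝ) - t|) ^ (-(7 / 4 : ℝ)) =
          (1 + |(m : ℝ) - t|) ^ (1 / 4 : ℝ) / (1 + |(m : ℝ) - t|) ^ 2 := by
        rw [eq_div_iff (by positivity), ← Real.rpow_natCast, ← Real.rpow_add hb]
        norm_num
      rw [e]
      calc A * Real.log ((m : ℝ) + 2) * (8 / (4 + (t - m) ^ 2))
          ≤ A * (9 * Real.log (|t| + 2) * (1 + |(m : ℝ) - t|) ^ (1 / 4 : ℝ)) *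
              (8 / (4 + (t - m) ^ 2)) :=
            mul_le_mul_of_nonneg_right (mul_le_mul_of_nonneg_left h1 hA0.le) (by positivity)
        _ ≤ A * (9 * Real.log (|t| + 2) * (1 + |(m : ℝ) - t|) ^ (1 / 4 : ℝ)) *
              (16 / (1 + |(m : ℝ) - t|) ^ 2) :=
            mul_le_mul_of_nonneg_left h2 (mul_nonneg hA0.le (by positivity))
        _ = 144 * A * Real.log (|t| + 2) *
              ((1 + |(m : ℝ) - t|) ^ (1 / 4 : ℝ) / (1 + |(m : ℝ) - t|) ^ 2) := by ring
    have step3 : ∑ m ∈ W, (1 + |(m : ℝ) - t|) ^ (-(7 / 4 : ℝ)) ≤ 2 ^ (7 / 4 : ℝ) * J := by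
      have hint : Integrable fun u : ℝ ↦ 2 ^ (7 / 4 : ℝ) * (1 + ‖u - t‖) ^ (-(7 / 4 : ℝ)) :=
        (hJint.comp_sub_right t).const_mul _
      calc ∑ m ∈ W, (1 + |(m : ℝ) - t|) ^ (-(7 / 4 : ℝ))
          ≤ ∫ u in Set.univ, 2 ^ (7 / 4 : ℝ) * (1 + ‖u - t‖) ^ (-(7 / 4 : ℝ)) := by
            refine sum_le_setIntegral_of_le_on_cells W _ MeasurableSet.univ
              (fun _ _ ↦ subset_univ _) hint.integrableOn (fun u _ ↦ by positivity)
              fun m _ u hu1 hu2 ↦ ?_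
            rw [Real.norm_eq_abs]
            have hb : 0 < (1 + |u - t|) / 2 := by positivity
            have hle : (1 + |u - t|) / 2 ≤ 1 + |(m : ℝ) - t| := by
              have := abs_sub_le u m t
              have : |u - (m : ℝ)| ≤ 1 := by rw [abs_le]; constructor <;> linarith
              linarith [abs_nonneg ((m : ℝ) - t)]
            calc (1 + |(m : ℝ) - t|) ^ (-(7 / 4 : ℝ)) ≤ ((1 + |u - t|) / 2) ^ (-(7 / 4 : ℝ)) :=
                  Real.rpow_le_rpow_of_nonpos hb hle (by norm_num)
              _ = 2 ^ (7 / 4 : ℝ) * (1 + |u - t|) ^ (-(7 / 4 : ℝ)) := by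
                  rw [Real.div_rpow (by positivity) (by norm_num),
                    Real.rpow_neg (by norm_num : (0 : ℝ) ≤ 2), div_inv_eq_mul, mul_comm]
        _ = 2 ^ (7 / 4 : ℝ) * J := by
            rw [setIntegral_univ, MeasureTheory.integral_const_mul]
            congr 1
            exact integral_sub_right_eq_self (fun v : ℝ ↦ (1 + ‖v‖) ^ (-(7 / 4 : ℝ))) t
    calc ∑ n ∈ S, 1 / (1 + (t - zetaOrdinate n) ^ 2)
        ≤ ∑ m ∈ W, A * Real.log ((m : ℝ) + 2) * (8 / (4 + (t - m) ^ 2)) := step1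
      _ ≤ ∑ m ∈ W, 144 * A * Real.log (|t| + 2) * (1 + |(m : ℝ) - t|) ^ (-(7 / 4 : ℝ)) :=
          Finset.sum_le_sum step2
      _ = 144 * A * Real.log (|t| + 2) * ∑ m ∈ W, (1 + |(m : ℝ) - t|) ^ (-(7 / 4 : ℝ)) := by
          rw [Finset.mul_sum]
      _ ≤ 144 * A * Real.log (|t| + 2) * (2 ^ (7 / 4 : ℝ) * J) :=
          mul_le_mul_of_nonneg_left step3 (by positivity)
      _ = 144 * A * (2 ^ (7 / 4 : ℝ) * J) * Real.log (|t| + 2) := by ring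
  refine ⟨144 * A * (2 ^ (7 / 4 : ℝ) * J) + 1, by positivity, fun t ↦ ?_⟩
  have hnn : ∀ n : ℕ, 0 ≤ 1 / (1 + (t - zetaOrdinate n) ^ 2) := fun n ↦ by positivity
  have hsum : Summable fun n : ℕ ↦ 1 / (1 + (t - zetaOrdinate n) ^ 2) :=
    summable_of_sum_le hnn (key t)
  refine ⟨hsum, (Real.tsum_le_of_sum_le hnn (key t)).trans ?_⟩
  have hlog0 : 0 ≤ Real.log (|t| + 2) := Real.log_nonneg (by linarith [abs_nonneg t])
  nlinarith


/-! ## Elementary `arctan` estimates -/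

/-- `t ↦ 1/(1+t²)` is continuous. [folklore] -/
theorem continuous_one_div_one_add_sq : Continuous fun t : ℝ ↦ 1 / (1 + t ^ 2) :=
  continuous_const.div (by fun_prop) fun t ↦ by positivity

/-- `π/2 − arctan a ≤ 1/a` for `a > 0` (`π/2 − arctan a = arctan (1/a)`). [folklore] -/
theorem pi_div_two_sub_arctan_le_inv {a : ℝ} (ha : 0 < a) : π / 2 - Real.arctan a ≤ 1 / a := by
  rw [← Real.arctan_inv_of_pos ha, one_div]
  -- `arctan y ≤ tan (arctan y) = y` for `0 ≤ arctan y < π/2`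
  have h := Real.le_tan (Real.arctan_nonneg.2 (inv_nonneg.2 ha.le)) (Real.arctan_lt_pi_div_two _)
  rwa [Real.tan_arctan] at h

/-- For `0 ≤ a ≤ b`: `arctan b − arctan a ≤ (b − a)/(1 + a²)` (the integrand `1/(1+t²)` is at most
`1/(1+a²)` on `[a, b]`). [folklore] -/
theorem arctan_sub_arctan_le {a b : ℝ} (ha : 0 ≤ a) (hab : a ≤ b) :
    Real.arctan b - Real.arctan a ≤ (b - a) / (1 + a ^ 2) := by
  have h : ∫ t in a..b, (1 : ℝ) / (1 + t ^ 2) ≤ ∫ _ in a..b, (1 : ℝ) / (1 + a ^ 2) :=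
    intervalIntegral.integral_mono_on hab (continuous_one_div_one_add_sq.intervalIntegrable _ _)
      intervalIntegrable_const fun t ht ↦ by
        apply one_div_le_one_div_of_le (by positivity)
        nlinarith [ht.1, ha]
  rw [integral_one_div_one_add_sq, intervalIntegral.integral_const, smul_eq_mul] at h
  calc Real.arctan b - Real.arctan a ≤ (b - a) * (1 / (1 + a ^ 2)) := h
    _ = (b - a) / (1 + a ^ 2) := by ring

/-- `arctan b − arctan a < π`. [folklore] -/
theorem arctan_sub_arctan_lt_pi (a b : ℝ) : Real.arctan b - Real.arctan a < π := by
  linarith [Real.arctan_lt_pi_div_two b, Real.neg_pi_div_two_lt_arctan a]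

/-- `0 ≤ arctan b − arctan a` for `a ≤ b`. [folklore] -/
theorem arctan_sub_arctan_nonneg {a b : ℝ} (hab : a ≤ b) : 0 ≤ Real.arctan b - Real.arctan a :=
  sub_nonneg.2 (Real.arctan_mono hab)

/-- `0 < π/2 − arctan a < π`. [folklore] -/
theorem pi_div_two_sub_arctan_mem (a : ℝ) : 0 < π / 2 - Real.arctan a ∧ π / 2 - Real.arctan a < π := by
  constructor <;> linarith [Real.arctan_lt_pi_div_two a, Real.neg_pi_div_two_lt_arctan a]

/-! ## Two elementary sums: harmonic numbers and `∑ log(m+2)/m²` over far windows -/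

/-- `∑_{j=1}^{J} 1/j ≤ 1 + log J`. [folklore] -/
theorem sum_Icc_one_div_le_log (J : ℕ) : ∑ j ∈ Finset.Icc 1 J, 1 / (j : ℝ) ≤ 1 + Real.log J := by
  induction J with
  | zero => simp
  | succ J ih =>
    rw [Finset.sum_Icc_succ_top (by omega)]
    rcases Nat.eq_zero_or_pos J with rfl | hJ
    · simp
    · have hJ0 : (0 : ℝ) < J := by exact_mod_cast hJ
      have hlog : Real.log J + 1 / ((J : ℝ) + 1) ≤ Real.log ((J : ℝ) + 1) := by
        have h := Real.log_le_sub_one_of_pos (by positivity : (0 : ℝ) < J / (J + 1))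
        rw [Real.log_div hJ0.ne' (by positivity)] at h
        have e : (J : ℝ) / (J + 1) - 1 = -(1 / (J + 1)) := by field_simp; ring
        linarith
      push_cast
      linarith

/-- The telescoping inequality `log(m+2)/m² ≤ Φ(m) − Φ(m+1)`, `Φ(m) = 2(log(m+2)+1)/(2m−1)`, for
real `m ≥ 1`. [folklore] -/
theorem log_div_sq_le_telescope {m : ℝ} (hm : 1 ≤ m) :
    Real.log (m + 2) / m ^ 2 ≤
      2 * (Real.log (m + 2) + 1) / (2 * m - 1) - 2 * (Real.log (m + 3) + 1) / (2 * m + 1) := by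
  have h1 : 0 < 2 * m - 1 := by linarith
  have h0 : 0 < m := by linarith
  have h1' : 2 * m - 1 ≠ 0 := h1.ne'
  have h2' : 2 * m + 1 ≠ 0 := by positivity
  have h0' : m ≠ 0 := h0.ne'
  set L2 := Real.log (m + 2) with hL2
  set L3 := Real.log (m + 3) with hL3
  have hL20 : 0 ≤ L2 := Real.log_nonneg (by linarith)
  have hd0 : 0 ≤ L3 - L2 := sub_nonneg.2 (Real.log_le_log (by linarith) (by linarith))
  have hd1 : (L3 - L2) * (m + 2) ≤ 1 := by
    have h := Real.log_le_sub_one_of_pos (by positivity : (0 : ℝ) < (m + 3) / (m + 2))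
    rw [Real.log_div (by positivity) (by positivity)] at h
    have e : (m + 3) / (m + 2) - 1 = 1 / (m + 2) := by field_simp; ring
    rw [e, ← hL2, ← hL3] at h
    have := mul_le_mul_of_nonneg_right h (by positivity : (0 : ℝ) ≤ m + 2)
    rwa [one_div, inv_mul_cancel₀ (by positivity)] at this
  have hd2 : (L3 - L2) * (2 * m - 1) ≤ 2 := by nlinarith
  have e : 2 * (L2 + 1) / (2 * m - 1) - 2 * (L3 + 1) / (2 * m + 1) - L2 / m ^ 2 =
      ((2 * (L2 + 1) * (2 * m + 1) - 2 * (L3 + 1) * (2 * m - 1)) * m ^ 2 -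
          L2 * ((2 * m - 1) * (2 * m + 1))) / (m ^ 2 * ((2 * m - 1) * (2 * m + 1))) := by
    field_simp
  have hnum : 0 ≤ (2 * (L2 + 1) * (2 * m + 1) - 2 * (L3 + 1) * (2 * m - 1)) * m ^ 2 -
      L2 * ((2 * m - 1) * (2 * m + 1)) := by
    have e2 : (2 * (L2 + 1) * (2 * m + 1) - 2 * (L3 + 1) * (2 * m - 1)) * m ^ 2 -
        L2 * ((2 * m - 1) * (2 * m + 1)) =
        (4 - 2 * ((L3 - L2) * (2 * m - 1))) * m ^ 2 + L2 := by ring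
    rw [e2]
    nlinarith [sq_nonneg m]
  have : 0 ≤ 2 * (L2 + 1) / (2 * m - 1) - 2 * (L3 + 1) / (2 * m + 1) - L2 / m ^ 2 := by
    rw [e]; positivity
  linarith

/-- Far windows: `∑_{m ∈ W} log(m+2)/m² ≤ 2(log(M+2)+1)/M` for a finite set `W` of naturals
`≥ M ≥ 1` (telescoping). [folklore] -/
theorem sum_log_div_sq_far_le {M : ℕ} (hM : 1 ≤ M) (W : Finset ℕ) (hW : ∀ m ∈ W, M ≤ m) :
    ∑ m ∈ W, Real.log ((m : ℝ) + 2) / (m : ℝ) ^ 2 ≤ 2 * (Real.log ((M : ℝ) + 2) + 1) / M := by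
  -- `f m = Φ(m)`
  set f : ℕ → ℝ := fun m ↦ 2 * (Real.log ((m : ℝ) + 2) + 1) / (2 * (m : ℝ) - 1) with hf
  have hf0 : ∀ m : ℕ, 1 ≤ m → 0 ≤ f m := fun m hm ↦ by
    have : (1 : ℝ) ≤ m := by exact_mod_cast hm
    have : 0 ≤ Real.log ((m : ℝ) + 2) := Real.log_nonneg (by linarith)
    rw [hf]; dsimp only; exact div_nonneg (by linarith) (by linarith)
  have hstep : ∀ m : ℕ, 1 ≤ m → Real.log ((m : ℝ) + 2) / (m : ℝ) ^ 2 ≤ f m - f (m + 1) := by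
    intro m hm
    have h := log_div_sq_le_telescope (by exact_mod_cast hm : (1 : ℝ) ≤ m)
    have e1 : f (m + 1) = 2 * (Real.log ((m : ℝ) + 3) + 1) / (2 * (m : ℝ) + 1) := by
      rw [hf]; dsimp only; push_cast; ring_nf
    rw [e1]
    exact h
  -- telescoping over `Ico M K`
  have htel : ∀ K : ℕ, ∑ m ∈ Finset.Ico M K, Real.log ((m : ℝ) + 2) / (m : ℝ) ^ 2 ≤ f M := by
    intro K
    rcases le_or_gt K M with hKM | hKM
    · rw [Finset.Ico_eq_empty_of_le hKM, Finset.sum_empty]; exact hf0 M hM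
    calc ∑ m ∈ Finset.Ico M K, Real.log ((m : ℝ) + 2) / (m : ℝ) ^ 2
        ≤ ∑ m ∈ Finset.Ico M K, (f m - f (m + 1)) :=
          Finset.sum_le_sum fun m hm ↦ hstep m (hM.trans (Finset.mem_Ico.1 hm).1)
      _ = f M - f K := by
          rw [Finset.sum_Ico_eq_sum_range]
          have := Finset.sum_range_sub' (fun i ↦ f (M + i)) (K - M)
          simp only [Nat.add_zero] at this
          rw [show M + (K - M) = K by omega] at this
          exact this
      _ ≤ f M := by linarith [hf0 K (by omega)]
  have hsub : W ⊆ Finset.Ico M (W.sup id + 1) := fun m hm ↦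
    Finset.mem_Ico.2 ⟨hW m hm, Nat.lt_succ_of_le (Finset.le_sup (f := id) hm)⟩
  have hM1 : (1 : ℝ) ≤ M := by exact_mod_cast hM
  have hlogM : 0 ≤ Real.log ((M : ℝ) + 2) := Real.log_nonneg (by linarith)
  calc ∑ m ∈ W, Real.log ((m : ℝ) + 2) / (m : ℝ) ^ 2
      ≤ ∑ m ∈ Finset.Ico M (W.sup id + 1), Real.log ((m : ℝ) + 2) / (m : ℝ) ^ 2 := by
        refine Finset.sum_le_sum_of_subset_of_nonneg hsub fun m hm _ ↦ ?_
        have : (1 : ℝ) ≤ m := by exact_mod_cast hM.trans (Finset.mem_Ico.1 hm).1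
        have : 0 ≤ Real.log ((m : ℝ) + 2) := Real.log_nonneg (by linarith)
        positivity
    _ ≤ f M := htel _
    _ = 2 * (Real.log ((M : ℝ) + 2) + 1) / (2 * (M : ℝ) - 1) := rfl
    _ ≤ 2 * (Real.log ((M : ℝ) + 2) + 1) / M := by
        rw [div_le_div_iff₀ (by linarith) (by positivity)]
        nlinarith


/-! ## Harmonic sums in three guises -/

/-- `log x + 1/(x+1) ≤ log(x+1)` for `x > 0`. [folklore] -/
theorem log_add_one_div_le {x : ℝ} (hx : 0 < x) : Real.log x + 1 / (x + 1) ≤ Real.log (x + 1) := by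
  have h := Real.log_le_sub_one_of_pos (by positivity : (0 : ℝ) < x / (x + 1))
  rw [Real.log_div hx.ne' (by positivity)] at h
  have e : x / (x + 1) - 1 = -(1 / (x + 1)) := by field_simp; ring
  linarith

/-- `∑_{m<K} 1/(m+1) ≤ 1 + log K`. [folklore] -/
theorem sum_range_one_div_succ_le_log (K : ℕ) :
    ∑ m ∈ Finset.range K, 1 / ((m : ℝ) + 1) ≤ 1 + Real.log K := by
  induction K with
  | zero => simp
  | succ K ih =>
    rw [Finset.sum_range_succ]
    rcases Nat.eq_zero_or_pos K with rfl | hK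
    · simp
    · have := log_add_one_div_le (by exact_mod_cast hK : (0 : ℝ) < K)
      push_cast
      linarith

/-- `∑_{m=c+1}^{c+J} 1/(m−c) ≤ 1 + log J`. [folklore] -/
theorem sum_Icc_one_div_sub_le_log (c J : ℕ) :
    ∑ m ∈ Finset.Icc (c + 1) (c + J), 1 / ((m : ℝ) - c) ≤ 1 + Real.log J := by
  induction J with
  | zero => simp
  | succ J ih =>
    rw [show c + (J + 1) = c + J + 1 by ring, Finset.sum_Icc_succ_top (by omega)]
    have e : ((c + J + 1 : ℕ) : ℝ) - c = (J : ℝ) + 1 := by push_cast; ring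
    rw [e]
    rcases Nat.eq_zero_or_pos J with rfl | hJ
    · simp
    · have := log_add_one_div_le (by exact_mod_cast hJ : (0 : ℝ) < J)
      push_cast
      linarith

/-- `∑_{m<J} 1/(J−m) ≤ 1 + log J`. [folklore] -/
theorem sum_range_one_div_sub_le_log (J : ℕ) :
    ∑ m ∈ Finset.range J, 1 / ((J : ℝ) - m) ≤ 1 + Real.log J := by
  induction J with
  | zero => simp
  | succ J ih =>
    rw [Finset.sum_range_succ']
    have e : ∀ m : ℕ, ((J + 1 : ℕ) : ℝ) - ((m + 1 : ℕ) : ℝ) = (J : ℝ) - m := fun m ↦ by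
      push_cast; ring
    simp only [e, Nat.cast_zero, sub_zero]
    rcases Nat.eq_zero_or_pos J with rfl | hJ
    · simp
    · have := log_add_one_div_le (by exact_mod_cast hJ : (0 : ℝ) < J)
      push_cast
      linarith

/-! ## Window sums: the near and the far range -/

/-- Near range: if all windows of `W` are `≤ K`, then
`∑_{n∈s} φ n ≤ A log(K+2) ∑_{m∈W} G m`. [folklore] -/
theorem near_sum_le {A : ℝ} (hA0 : 0 < A)
    (hA : ∀ a : ℝ, 0 ≤ a → (zetaZeroCount (a + 1) : ℝ) - zetaZeroCount a ≤ A * Real.log (a + 2))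
    (s W : Finset ℕ) (K : ℕ) (hWK : ∀ m ∈ W, m ≤ K) (hW : ∀ n ∈ s, ⌈zetaOrdinate n⌉₊ - 1 ∈ W)
    (φ : ℕ → ℝ) (G : ℕ → ℝ) (hG0 : ∀ m ∈ W, 0 ≤ G m)
    (hgG : ∀ n ∈ s, φ n ≤ G (⌈zetaOrdinate n⌉₊ - 1)) :
    ∑ n ∈ s, φ n ≤ A * Real.log ((K : ℝ) + 2) * ∑ m ∈ W, G m := by
  refine (sum_le_sum_windows_log hA s W hW φ G hG0 hgG).trans ?_
  rw [Finset.mul_sum]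
  refine Finset.sum_le_sum fun m hm ↦ mul_le_mul_of_nonneg_right ?_ (hG0 m hm)
  refine mul_le_mul_of_nonneg_left (Real.log_le_log (by positivity) ?_) hA0.le
  have : (m : ℝ) ≤ K := by exact_mod_cast hWK m hm
  linarith

/-- `log` of quantities `≤ (T+2)²` is at most `2 log(T+2)`. [folklore] -/
theorem log_le_two_mul_log {y T : ℝ} (hy : 0 < y) (hyT : y ≤ (T + 2) ^ 2) :
    Real.log y ≤ 2 * Real.log (T + 2) := by
  calc Real.log y ≤ Real.log ((T + 2) ^ 2) := Real.log_le_log hy hyT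
    _ = 2 * Real.log (T + 2) := by rw [Real.log_pow]; push_cast; ring

/-- `1 ≤ log(T+2)` for `T ≥ 2`. [folklore] -/
theorem one_le_log_add_two {T : ℝ} (hT : 2 ≤ T) : 1 ≤ Real.log (T + 2) := by
  rw [Real.le_log_iff_exp_le (by linarith)]
  have := Real.exp_one_lt_d9
  linarith

/-- Far range: indices with `γ_n > 2⌈T⌉ + 1` and terms `φ n ≤ 4T/m²` (`m` the window of `n`)
contribute `≤ 16 A log²(T+2)`. [folklore] -/
theorem far_sum_le {A : ℝ} (hA0 : 0 < A)
    (hA : ∀ a : ℝ, 0 ≤ a → (zetaZeroCount (a + 1) : ℝ) - zetaZeroCount a ≤ A * Real.log (a + 2))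
    {T : ℝ} (hT : 2 ≤ T) (s : Finset ℕ) (φ : ℕ → ℝ)
    (hs : ∀ n ∈ s, (2 * ⌈T⌉₊ + 1 : ℝ) < zetaOrdinate n)
    (hφ : ∀ n ∈ s, φ n ≤ 4 * T / ((⌈zetaOrdinate n⌉₊ - 1 : ℕ) : ℝ) ^ 2) :
    ∑ n ∈ s, φ n ≤ 16 * A * Real.log (T + 2) ^ 2 := by
  have hT0 : 0 ≤ T := by linarith
  set Tc : ℕ := ⌈T⌉₊ with hTc
  have hTTc : T ≤ Tc := Nat.le_ceil T
  have hTc1 : (Tc : ℝ) < T + 1 := Nat.ceil_lt_add_one hT0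
  set L := Real.log (T + 2) with hLdef
  have hL1 : 1 ≤ L := one_le_log_add_two hT
  set M : ℕ := 2 * Tc + 1 with hM
  set W := s.image (fun n ↦ ⌈zetaOrdinate n⌉₊ - 1) with hWdef
  have hW : ∀ n ∈ s, ⌈zetaOrdinate n⌉₊ - 1 ∈ W := fun n hn ↦ Finset.mem_image_of_mem _ hn
  have hWM : ∀ m ∈ W, M ≤ m := by
    intro m hm
    rw [hWdef, Finset.mem_image] at hm
    obtain ⟨n, hn, rfl⟩ := hm
    have : 2 * Tc + 1 < ⌈zetaOrdinate n⌉₊ := Nat.lt_ceil.2 (by exact_mod_cast hs n hn)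
    omega
  have h1 := sum_le_sum_windows_log hA s W hW φ (fun m ↦ 4 * T / (m : ℝ) ^ 2)
    (fun m _ ↦ by positivity) hφ
  have h2 : ∑ m ∈ W, A * Real.log ((m : ℝ) + 2) * (4 * T / (m : ℝ) ^ 2) =
      4 * T * A * ∑ m ∈ W, Real.log ((m : ℝ) + 2) / (m : ℝ) ^ 2 := by
    rw [Finset.mul_sum]
    exact Finset.sum_congr rfl fun m _ ↦ by ring
  have h3 := sum_log_div_sq_far_le (by omega : 1 ≤ M) W hWM
  have hM2T : 2 * T ≤ M := by rw [hM]; push_cast; linarith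
  have hM0 : (0 : ℝ) < M := by positivity
  have hTM : T / M ≤ 1 / 2 := by
    rw [div_le_iff₀ hM0]; linarith
  have hlogM : Real.log ((M : ℝ) + 2) ≤ 2 * L :=
    log_le_two_mul_log (by positivity) (by rw [hM]; push_cast; nlinarith)
  calc ∑ n ∈ s, φ n ≤ _ := h1
    _ = 4 * T * A * ∑ m ∈ W, Real.log ((m : ℝ) + 2) / (m : ℝ) ^ 2 := h2
    _ ≤ 4 * T * A * (2 * (Real.log ((M : ℝ) + 2) + 1) / M) :=
        mul_le_mul_of_nonneg_left h3 (by positivity)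
    _ = 8 * A * (Real.log ((M : ℝ) + 2) + 1) * (T / M) := by ring
    _ ≤ 8 * A * (2 * L + 1) * (1 / 2) := by
        apply mul_le_mul (by nlinarith [hlogM, hA0]) hTM (by positivity) (by positivity)
    _ ≤ 16 * A * L ^ 2 := by
        have hAL : A ≤ A * L := by nlinarith
        have hAL2 : A * L ≤ A * L ^ 2 := by nlinarith
        nlinarith

/-- **(Za)** `∑_{γ_n > T} (arctan γ_n − arctan(γ_n − T)) ≪ log²(T+2)` over any finite set of such
indices (`T ≥ 2`): near windows contribute `π` or `1/(m − ⌈T⌉)` (a harmonic sum), far windows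
`4T/m²`. This is `∫_0^T ∑_{γ>T} dt/(1+(t−γ)²)`. [folklore] -/
theorem exists_sum_arctan_sub_arctan_sub_le :
    ∃ B : ℝ, 0 < B ∧ ∀ T : ℝ, 2 ≤ T → ∀ s : Finset ℕ, (∀ n ∈ s, T < zetaOrdinate n) →
      ∑ n ∈ s, (Real.arctan (zetaOrdinate n) - Real.arctan (zetaOrdinate n - T)) ≤
        B * Real.log (T + 2) ^ 2 := by
  obtain ⟨A, hA0, hA⟩ := exists_zetaZeroCount_add_one_sub_le
  refine ⟨34 * A, by positivity, fun T hT s hs ↦ ?_⟩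
  have hT0 : 0 ≤ T := by linarith
  set Tc : ℕ := ⌈T⌉₊ with hTc
  have hTTc : T ≤ Tc := Nat.le_ceil T
  have hTc1 : (Tc : ℝ) < T + 1 := Nat.ceil_lt_add_one hT0
  have hTc2 : 2 ≤ Tc := by
    have : (2 : ℝ) ≤ Tc := hT.trans hTTc
    exact_mod_cast this
  set L := Real.log (T + 2) with hLdef
  have hL1 : 1 ≤ L := one_le_log_add_two hT
  have hL0 : 0 < L := by linarith
  have hlogTc : Real.log Tc ≤ L := Real.log_le_log (by positivity) (by linarith)
  set φ : ℕ → ℝ := fun n ↦ Real.arctan (zetaOrdinate n) - Real.arctan (zetaOrdinate n - T)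
    with hφ
  have hφπ : ∀ n, φ n ≤ π := fun n ↦ (arctan_sub_arctan_lt_pi _ _).le
  rw [← Finset.sum_filter_add_sum_filter_not s (fun n ↦ zetaOrdinate n ≤ 2 * Tc + 1)]
  set s₁ := s.filter (fun n ↦ zetaOrdinate n ≤ 2 * Tc + 1) with hs₁
  set s₂ := s.filter (fun n ↦ ¬ zetaOrdinate n ≤ 2 * Tc + 1) with hs₂
  -- the near range
  have hnear : ∑ n ∈ s₁, φ n ≤ 18 * A * L ^ 2 := by
    set W := Finset.Icc (Tc - 1) (2 * Tc) with hW
    set G : ℕ → ℝ := fun m ↦ if m ≤ Tc then π else 1 / ((m : ℝ) - Tc) with hG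
    have hG0 : ∀ m, 0 ≤ G m := fun m ↦ by
      rw [hG]; dsimp only; split_ifs with h
      · positivity
      · push Not at h
        have : (Tc : ℝ) < m := by exact_mod_cast h
        exact div_nonneg zero_le_one (by linarith)
    have hWmem : ∀ n ∈ s₁, ⌈zetaOrdinate n⌉₊ - 1 ∈ W := by
      intro n hn
      rw [hs₁, Finset.mem_filter] at hn
      have hγT : T < zetaOrdinate n := hs n hn.1
      rw [hW, Finset.mem_Icc]
      constructor
      · exact Nat.sub_le_sub_right (Nat.ceil_mono hγT.le) 1
      · have : ⌈zetaOrdinate n⌉₊ ≤ 2 * Tc + 1 := Nat.ceil_le.2 (by exact_mod_cast hn.2)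
        omega
    have hgG : ∀ n ∈ s₁, φ n ≤ G (⌈zetaOrdinate n⌉₊ - 1) := by
      intro n hn
      rw [hs₁, Finset.mem_filter] at hn
      have hγT : T < zetaOrdinate n := hs n hn.1
      obtain ⟨hw1, hw2⟩ := window_spec n
      rw [hG]; dsimp only
      split_ifs with hm
      · exact hφπ n
      · push Not at hm
        have hmT : (Tc : ℝ) + 1 ≤ ((⌈zetaOrdinate n⌉₊ - 1 : ℕ) : ℝ) := by exact_mod_cast hm
        have hpos : 0 < ((⌈zetaOrdinate n⌉₊ - 1 : ℕ) : ℝ) - Tc := by linarith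
        have hγ : ((⌈zetaOrdinate n⌉₊ - 1 : ℕ) : ℝ) - Tc ≤ zetaOrdinate n - T := by linarith
        calc φ n ≤ π / 2 - Real.arctan (zetaOrdinate n - T) := by
              rw [hφ]; dsimp only; linarith [Real.arctan_lt_pi_div_two (zetaOrdinate n)]
          _ ≤ 1 / (zetaOrdinate n - T) := pi_div_two_sub_arctan_le_inv (by linarith)
          _ ≤ 1 / (((⌈zetaOrdinate n⌉₊ - 1 : ℕ) : ℝ) - Tc) := one_div_le_one_div_of_le hpos hγ
    have h1 := near_sum_le hA0 hA s₁ W (2 * Tc) (fun m hm ↦ (Finset.mem_Icc.1 (hW ▸ hm)).2)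
      hWmem φ G (fun m _ ↦ hG0 m) hgG
    have h3 : ∑ m ∈ W, G m ≤ 2 * π + (1 + Real.log Tc) := by
      rw [← Finset.sum_filter_add_sum_filter_not W (fun m ↦ m ≤ Tc)]
      apply add_le_add
      · have hcard : (W.filter (fun m ↦ m ≤ Tc)).card ≤ 2 := by
          calc (W.filter (fun m ↦ m ≤ Tc)).card ≤ (Finset.Icc (Tc - 1) Tc).card :=
                Finset.card_le_card fun m hm ↦ by
                  rw [Finset.mem_filter, hW, Finset.mem_Icc] at hm
                  rw [Finset.mem_Icc]; omega
            _ = 2 := by rw [Nat.card_Icc]; omega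
        calc ∑ m ∈ W.filter (fun m ↦ m ≤ Tc), G m = ∑ m ∈ W.filter (fun m ↦ m ≤ Tc), π := by
              refine Finset.sum_congr rfl fun m hm ↦ ?_
              rw [Finset.mem_filter] at hm
              rw [hG]; dsimp only; rw [if_pos hm.2]
          _ = (W.filter (fun m ↦ m ≤ Tc)).card * π := by rw [Finset.sum_const, nsmul_eq_mul]
          _ ≤ 2 * π := by
              have : ((W.filter (fun m ↦ m ≤ Tc)).card : ℝ) ≤ 2 := by exact_mod_cast hcard
              nlinarith [Real.pi_pos]
      · have hfilt : W.filter (fun m ↦ ¬ m ≤ Tc) = Finset.Icc (Tc + 1) (Tc + Tc) := by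
          ext m
          rw [Finset.mem_filter, hW, Finset.mem_Icc, Finset.mem_Icc]
          omega
        rw [hfilt]
        calc ∑ m ∈ Finset.Icc (Tc + 1) (Tc + Tc), G m
            = ∑ m ∈ Finset.Icc (Tc + 1) (Tc + Tc), 1 / ((m : ℝ) - Tc) := by
              refine Finset.sum_congr rfl fun m hm ↦ ?_
              rw [Finset.mem_Icc] at hm
              rw [hG]; dsimp only; rw [if_neg (by omega)]
          _ ≤ 1 + Real.log Tc := sum_Icc_one_div_sub_le_log Tc Tc
    have hlog2Tc : Real.log (((2 * Tc : ℕ) : ℝ) + 2) ≤ 2 * L :=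
      log_le_two_mul_log (by positivity) (by push_cast; nlinarith)
    calc ∑ n ∈ s₁, φ n ≤ A * Real.log (((2 * Tc : ℕ) : ℝ) + 2) * ∑ m ∈ W, G m := h1
      _ ≤ A * (2 * L) * (2 * π + (1 + Real.log Tc)) := by
          apply mul_le_mul (mul_le_mul_of_nonneg_left hlog2Tc hA0.le) h3
            (Finset.sum_nonneg fun m _ ↦ hG0 m) (by positivity)
      _ ≤ A * (2 * L) * (9 * L) := by
          apply mul_le_mul_of_nonneg_left _ (by positivity)
          linarith [Real.pi_lt_d2]
      _ = 18 * A * L ^ 2 := by ring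
  -- the far range
  have hfar : ∑ n ∈ s₂, φ n ≤ 16 * A * L ^ 2 := by
    refine far_sum_le hA0 hA hT s₂ φ (fun n hn ↦ ?_) fun n hn ↦ ?_
    · rw [hs₂, Finset.mem_filter, not_le] at hn
      exact_mod_cast hn.2
    · rw [hs₂, Finset.mem_filter, not_le] at hn
      have hγT : T < zetaOrdinate n := hs n hn.1
      obtain ⟨hw1, hw2⟩ := window_spec n
      have hbig : (2 * Tc + 1 : ℝ) < zetaOrdinate n := by exact_mod_cast hn.2
      have hm : 2 * Tc + 1 ≤ ⌈zetaOrdinate n⌉₊ - 1 := by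
        have : 2 * Tc + 1 < ⌈zetaOrdinate n⌉₊ := Nat.lt_ceil.2 (by exact_mod_cast hn.2)
        omega
      have hmM : (2 * Tc + 1 : ℝ) ≤ ((⌈zetaOrdinate n⌉₊ - 1 : ℕ) : ℝ) := by exact_mod_cast hm
      have key : ((⌈zetaOrdinate n⌉₊ - 1 : ℕ) : ℝ) ≤ 2 * (zetaOrdinate n - T) := by linarith
      have hm0 : (0 : ℝ) < ((⌈zetaOrdinate n⌉₊ - 1 : ℕ) : ℝ) := by linarith
      calc φ n ≤ (zetaOrdinate n - (zetaOrdinate n - T)) / (1 + (zetaOrdinate n - T) ^ 2) :=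
            arctan_sub_arctan_le (by linarith) (by linarith)
        _ = T / (1 + (zetaOrdinate n - T) ^ 2) := by ring
        _ ≤ 4 * T / ((⌈zetaOrdinate n⌉₊ - 1 : ℕ) : ℝ) ^ 2 := by
            rw [div_le_div_iff₀ (by positivity) (by positivity)]
            have hsq : ((⌈zetaOrdinate n⌉₊ - 1 : ℕ) : ℝ) ^ 2 ≤ 4 * (zetaOrdinate n - T) ^ 2 := by
              nlinarith
            nlinarith
  linarith

/-- **(Zb)** `∑_n (arctan(T + γ_n) − arctan γ_n) ≪ log²(T+2)` over any finite set of indices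
(`T ≥ 2`): this is `∫_0^T ∑_γ dt/(1+(t+γ)²)`. [folklore] -/
theorem exists_sum_arctan_add_sub_arctan_le :
    ∃ B : ℝ, 0 < B ∧ ∀ T : ℝ, 2 ≤ T → ∀ s : Finset ℕ,
      ∑ n ∈ s, (Real.arctan (T + zetaOrdinate n) - Real.arctan (zetaOrdinate n)) ≤
        B * Real.log (T + 2) ^ 2 := by
  obtain ⟨A, hA0, hA⟩ := exists_zetaZeroCount_add_one_sub_le
  refine ⟨30 * A, by positivity, fun T hT s ↦ ?_⟩
  have hT0 : 0 ≤ T := by linarith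
  set Tc : ℕ := ⌈T⌉₊ with hTc
  have hTTc : T ≤ Tc := Nat.le_ceil T
  have hTc1 : (Tc : ℝ) < T + 1 := Nat.ceil_lt_add_one hT0
  set L := Real.log (T + 2) with hLdef
  have hL1 : 1 ≤ L := one_le_log_add_two hT
  have hL0 : 0 < L := by linarith
  set φ : ℕ → ℝ := fun n ↦ Real.arctan (T + zetaOrdinate n) - Real.arctan (zetaOrdinate n) with hφ
  have hφπ : ∀ n, φ n ≤ π := fun n ↦ (arctan_sub_arctan_lt_pi _ _).le
  rw [← Finset.sum_filter_add_sum_filter_not s (fun n ↦ zetaOrdinate n ≤ 2 * Tc + 1)]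
  set s₁ := s.filter (fun n ↦ zetaOrdinate n ≤ 2 * Tc + 1) with hs₁
  set s₂ := s.filter (fun n ↦ ¬ zetaOrdinate n ≤ 2 * Tc + 1) with hs₂
  have hnear : ∑ n ∈ s₁, φ n ≤ 14 * A * L ^ 2 := by
    set W := Finset.range (2 * Tc + 1) with hW
    set G : ℕ → ℝ := fun m ↦ if m = 0 then π else 1 / (m : ℝ) with hG
    have hG0 : ∀ m, 0 ≤ G m := fun m ↦ by
      rw [hG]; dsimp only; split_ifs <;> positivity
    have hWmem : ∀ n ∈ s₁, ⌈zetaOrdinate n⌉₊ - 1 ∈ W := by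
      intro n hn
      rw [hs₁, Finset.mem_filter] at hn
      have : ⌈zetaOrdinate n⌉₊ ≤ 2 * Tc + 1 := Nat.ceil_le.2 (by exact_mod_cast hn.2)
      rw [hW, Finset.mem_range]; omega
    have hgG : ∀ n ∈ s₁, φ n ≤ G (⌈zetaOrdinate n⌉₊ - 1) := by
      intro n hn
      obtain ⟨hw1, hw2⟩ := window_spec n
      rw [hG]; dsimp only
      split_ifs with hm
      · exact hφπ n
      · have hm1 : (1 : ℝ) ≤ ((⌈zetaOrdinate n⌉₊ - 1 : ℕ) : ℝ) := by
          exact_mod_cast Nat.one_le_iff_ne_zero.2 hm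
        have hγ0 : 0 < zetaOrdinate n := by linarith
        calc φ n ≤ π / 2 - Real.arctan (zetaOrdinate n) := by
              rw [hφ]; dsimp only; linarith [Real.arctan_lt_pi_div_two (T + zetaOrdinate n)]
          _ ≤ 1 / zetaOrdinate n := pi_div_two_sub_arctan_le_inv hγ0
          _ ≤ 1 / ((⌈zetaOrdinate n⌉₊ - 1 : ℕ) : ℝ) := one_div_le_one_div_of_le (by linarith) hw1.le
    have h1 := near_sum_le hA0 hA s₁ W (2 * Tc) (fun m hm ↦ by
      rw [hW, Finset.mem_range] at hm; omega) hWmem φ G (fun m _ ↦ hG0 m) hgG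
    have h3 : ∑ m ∈ W, G m ≤ π + (1 + Real.log ((2 * Tc : ℕ) : ℝ)) := by
      rw [hW, Finset.sum_range_succ']
      have e0 : G 0 = π := by rw [hG]; dsimp only; rw [if_pos rfl]
      have e1 : ∀ m : ℕ, G (m + 1) = 1 / ((m : ℝ) + 1) := fun m ↦ by
        rw [hG]; dsimp only; rw [if_neg (by omega)]; push_cast; ring
      simp only [e0, e1]
      linarith [sum_range_one_div_succ_le_log (2 * Tc)]
    have hlog2Tc : Real.log (((2 * Tc : ℕ) : ℝ) + 2) ≤ 2 * L :=
      log_le_two_mul_log (by positivity) (by push_cast; nlinarith)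
    have hlog2Tc' : Real.log ((2 * Tc : ℕ) : ℝ) ≤ 2 * L := by
      rcases Nat.eq_zero_or_pos Tc with h0 | h0
      · simp [h0]; linarith
      · exact log_le_two_mul_log (by positivity) (by push_cast; nlinarith)
    calc ∑ n ∈ s₁, φ n ≤ A * Real.log (((2 * Tc : ℕ) : ℝ) + 2) * ∑ m ∈ W, G m := h1
      _ ≤ A * (2 * L) * (π + (1 + Real.log ((2 * Tc : ℕ) : ℝ))) := by
          apply mul_le_mul (mul_le_mul_of_nonneg_left hlog2Tc hA0.le) h3
            (Finset.sum_nonneg fun m _ ↦ hG0 m) (by positivity)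
      _ ≤ A * (2 * L) * (7 * L) := by
          apply mul_le_mul_of_nonneg_left _ (by positivity)
          linarith [Real.pi_lt_d2]
      _ = 14 * A * L ^ 2 := by ring
  have hfar : ∑ n ∈ s₂, φ n ≤ 16 * A * L ^ 2 := by
    refine far_sum_le hA0 hA hT s₂ φ (fun n hn ↦ ?_) fun n hn ↦ ?_
    · rw [hs₂, Finset.mem_filter, not_le] at hn
      exact_mod_cast hn.2
    · rw [hs₂, Finset.mem_filter, not_le] at hn
      obtain ⟨hw1, hw2⟩ := window_spec n
      have hγ0 : 0 < zetaOrdinate n := zetaOrdinate_pos_holds n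
      have hm0 : (0 : ℝ) ≤ ((⌈zetaOrdinate n⌉₊ - 1 : ℕ) : ℝ) := Nat.cast_nonneg _
      have hmpos : (0 : ℝ) < ((⌈zetaOrdinate n⌉₊ - 1 : ℕ) : ℝ) := by
        have hbig : (2 * Tc + 1 : ℝ) < zetaOrdinate n := by exact_mod_cast hn.2
        have hm : 2 * Tc + 1 ≤ ⌈zetaOrdinate n⌉₊ - 1 := by
          have : 2 * Tc + 1 < ⌈zetaOrdinate n⌉₊ := Nat.lt_ceil.2 (by exact_mod_cast hn.2)
          omega
        have : (2 * Tc + 1 : ℝ) ≤ ((⌈zetaOrdinate n⌉₊ - 1 : ℕ) : ℝ) := by exact_mod_cast hm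
        linarith
      calc φ n ≤ (T + zetaOrdinate n - zetaOrdinate n) / (1 + zetaOrdinate n ^ 2) :=
            arctan_sub_arctan_le hγ0.le (by linarith)
        _ = T / (1 + zetaOrdinate n ^ 2) := by ring
        _ ≤ 4 * T / ((⌈zetaOrdinate n⌉₊ - 1 : ℕ) : ℝ) ^ 2 := by
            rw [div_le_div_iff₀ (by positivity) (by positivity)]
            have hsq : ((⌈zetaOrdinate n⌉₊ - 1 : ℕ) : ℝ) ^ 2 ≤ zetaOrdinate n ^ 2 := by
              nlinarith
            nlinarith
  linarith

/-- **(Zc)** `∑_{γ_n ≤ T} (π/2 − arctan(T − γ_n)) ≪ log²(T+2)` (`T ≥ 2`): this is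
`∫_T^∞ ∑_{γ ≤ T} dt/(1+(t−γ)²)`; windows at distance `j` below `T` contribute `1/j`. [folklore] -/
theorem exists_sum_pi_div_two_sub_arctan_sub_le :
    ∃ B : ℝ, 0 < B ∧ ∀ T : ℝ, 2 ≤ T → ∀ s : Finset ℕ, (∀ n ∈ s, zetaOrdinate n ≤ T) →
      ∑ n ∈ s, (π / 2 - Real.arctan (T - zetaOrdinate n)) ≤ B * Real.log (T + 2) ^ 2 := by
  obtain ⟨A, hA0, hA⟩ := exists_zetaZeroCount_add_one_sub_le
  refine ⟨9 * A, by positivity, fun T hT s hs ↦ ?_⟩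
  have hT0 : 0 ≤ T := by linarith
  set Tf : ℕ := ⌊T⌋₊ with hTf
  have hTfT : (Tf : ℝ) ≤ T := Nat.floor_le hT0
  have hTTf : T < Tf + 1 := Nat.lt_floor_add_one T
  have hTf2 : 2 ≤ Tf := Nat.le_floor (by exact_mod_cast hT)
  set L := Real.log (T + 2) with hLdef
  have hL1 : 1 ≤ L := one_le_log_add_two hT
  have hL0 : 0 < L := by linarith
  have hlogT : Real.log T ≤ L := Real.log_le_log (by linarith) (by linarith)
  have hlogTf1 : Real.log ((Tf : ℝ) - 1) ≤ L := by
    rcases le_or_gt ((Tf : ℝ) - 1) 1 with h | h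
    · have : Real.log ((Tf : ℝ) - 1) ≤ 0 := Real.log_nonpos (by linarith [hTf2]) h
      linarith
    · exact Real.log_le_log (by linarith) (by linarith)
  set φ : ℕ → ℝ := fun n ↦ π / 2 - Real.arctan (T - zetaOrdinate n) with hφ
  have hφπ : ∀ n, φ n ≤ π := fun n ↦ (pi_div_two_sub_arctan_mem _).2.le
  set W := Finset.range (Tf + 1) with hW
  set G : ℕ → ℝ := fun m ↦ if Tf ≤ m + 1 then π else 1 / ((Tf : ℝ) - 1 - m) with hG
  have hG0 : ∀ m, 0 ≤ G m := fun m ↦ by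
    rw [hG]; dsimp only; split_ifs with h
    · positivity
    · push Not at h
      have : (m : ℝ) + 1 < Tf := by exact_mod_cast h
      exact div_nonneg zero_le_one (by linarith)
  have hWmem : ∀ n ∈ s, ⌈zetaOrdinate n⌉₊ - 1 ∈ W := by
    intro n hn
    have h1 : ⌈zetaOrdinate n⌉₊ ≤ ⌈T⌉₊ := Nat.ceil_mono (hs n hn)
    have h2 : ⌈T⌉₊ ≤ Tf + 1 := Nat.ceil_le_floor_add_one T
    rw [hW, Finset.mem_range]; omega
  have hgG : ∀ n ∈ s, φ n ≤ G (⌈zetaOrdinate n⌉₊ - 1) := by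
    intro n hn
    obtain ⟨hw1, hw2⟩ := window_spec n
    rw [hG]; dsimp only
    split_ifs with hm
    · exact hφπ n
    · push Not at hm
      have hm' : ((⌈zetaOrdinate n⌉₊ - 1 : ℕ) : ℝ) + 1 < Tf := by exact_mod_cast hm
      have hpos : 0 < (Tf : ℝ) - 1 - ((⌈zetaOrdinate n⌉₊ - 1 : ℕ) : ℝ) := by linarith
      have hγ : (Tf : ℝ) - 1 - ((⌈zetaOrdinate n⌉₊ - 1 : ℕ) : ℝ) ≤ T - zetaOrdinate n := by linarith
      calc φ n ≤ 1 / (T - zetaOrdinate n) := pi_div_two_sub_arctan_le_inv (by linarith)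
        _ ≤ 1 / ((Tf : ℝ) - 1 - ((⌈zetaOrdinate n⌉₊ - 1 : ℕ) : ℝ)) :=
            one_div_le_one_div_of_le hpos hγ
  have h1 := near_sum_le hA0 hA s W Tf (fun m hm ↦ by rw [hW, Finset.mem_range] at hm; omega)
    hWmem φ G (fun m _ ↦ hG0 m) hgG
  have h3 : ∑ m ∈ W, G m ≤ 2 * π + (1 + Real.log ((Tf : ℝ) - 1)) := by
    rw [← Finset.sum_filter_add_sum_filter_not W (fun m ↦ Tf ≤ m + 1)]
    apply add_le_add
    · have hcard : (W.filter (fun m ↦ Tf ≤ m + 1)).card ≤ 2 := by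
        calc (W.filter (fun m ↦ Tf ≤ m + 1)).card ≤ (Finset.Icc (Tf - 1) Tf).card :=
              Finset.card_le_card fun m hm ↦ by
                rw [Finset.mem_filter, hW, Finset.mem_range] at hm
                rw [Finset.mem_Icc]; omega
          _ = 2 := by rw [Nat.card_Icc]; omega
      calc ∑ m ∈ W.filter (fun m ↦ Tf ≤ m + 1), G m = ∑ m ∈ W.filter (fun m ↦ Tf ≤ m + 1), π := by
            refine Finset.sum_congr rfl fun m hm ↦ ?_
            rw [Finset.mem_filter] at hm
            rw [hG]; dsimp only; rw [if_pos hm.2]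
        _ = (W.filter (fun m ↦ Tf ≤ m + 1)).card * π := by rw [Finset.sum_const, nsmul_eq_mul]
        _ ≤ 2 * π := by
            have : ((W.filter (fun m ↦ Tf ≤ m + 1)).card : ℝ) ≤ 2 := by exact_mod_cast hcard
            nlinarith [Real.pi_pos]
    · have hfilt : W.filter (fun m ↦ ¬ Tf ≤ m + 1) = Finset.range (Tf - 1) := by
        ext m
        rw [Finset.mem_filter, hW, Finset.mem_range, Finset.mem_range]
        omega
      rw [hfilt]
      have hcast : ((Tf - 1 : ℕ) : ℝ) = (Tf : ℝ) - 1 := by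
        rw [Nat.cast_sub (by omega)]; push_cast; ring
      calc ∑ m ∈ Finset.range (Tf - 1), G m
          = ∑ m ∈ Finset.range (Tf - 1), 1 / (((Tf - 1 : ℕ) : ℝ) - m) := by
            refine Finset.sum_congr rfl fun m hm ↦ ?_
            rw [Finset.mem_range] at hm
            rw [hG]; dsimp only; rw [if_neg (by omega), hcast]
        _ ≤ 1 + Real.log ((Tf - 1 : ℕ) : ℝ) := sum_range_one_div_sub_le_log (Tf - 1)
        _ = 1 + Real.log ((Tf : ℝ) - 1) := by rw [hcast]
  have hlogTf : Real.log ((Tf : ℝ) + 2) ≤ L := Real.log_le_log (by positivity) (by linarith)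
  calc ∑ n ∈ s, φ n ≤ A * Real.log ((Tf : ℝ) + 2) * ∑ m ∈ W, G m := h1
    _ ≤ A * L * (2 * π + (1 + Real.log ((Tf : ℝ) - 1))) := by
        apply mul_le_mul (mul_le_mul_of_nonneg_left hlogTf hA0.le) h3
          (Finset.sum_nonneg fun m _ ↦ hG0 m) (by positivity)
    _ ≤ A * L * (9 * L) := by
        apply mul_le_mul_of_nonneg_left _ (by positivity)
        linarith [Real.pi_lt_d2]
    _ = 9 * A * L ^ 2 := by ring

/-- **(Zd)** `∑_{γ_n ≤ T} (π/2 − arctan γ_n) ≪ log²(T+2)` (`T ≥ 2`): this is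
`∫_{-∞}^0 ∑_{γ ≤ T} dt/(1+(t−γ)²)`; window `m ≥ 1` contributes `1/m`. [folklore] -/
theorem exists_sum_pi_div_two_sub_arctan_le :
    ∃ B : ℝ, 0 < B ∧ ∀ T : ℝ, 2 ≤ T → ∀ s : Finset ℕ, (∀ n ∈ s, zetaOrdinate n ≤ T) →
      ∑ n ∈ s, (π / 2 - Real.arctan (zetaOrdinate n)) ≤ B * Real.log (T + 2) ^ 2 := by
  obtain ⟨A, hA0, hA⟩ := exists_zetaZeroCount_add_one_sub_le
  refine ⟨7 * A, by positivity, fun T hT s hs ↦ ?_⟩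
  have hT0 : 0 ≤ T := by linarith
  set Tf : ℕ := ⌊T⌋₊ with hTf
  have hTfT : (Tf : ℝ) ≤ T := Nat.floor_le hT0
  have hTTf : T < Tf + 1 := Nat.lt_floor_add_one T
  set L := Real.log (T + 2) with hLdef
  have hL1 : 1 ≤ L := one_le_log_add_two hT
  have hL0 : 0 < L := by linarith
  have hlogTf' : Real.log (Tf : ℝ) ≤ L := by
    rcases Nat.eq_zero_or_pos Tf with h0 | h0
    · simp [h0]; linarith
    · exact Real.log_le_log (by exact_mod_cast h0) (by linarith)
  set φ : ℕ → ℝ := fun n ↦ π / 2 - Real.arctan (zetaOrdinate n) with hφ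
  have hφπ : ∀ n, φ n ≤ π := fun n ↦ (pi_div_two_sub_arctan_mem _).2.le
  set W := Finset.range (Tf + 1) with hW
  set G : ℕ → ℝ := fun m ↦ if m = 0 then π else 1 / (m : ℝ) with hG
  have hG0 : ∀ m, 0 ≤ G m := fun m ↦ by
    rw [hG]; dsimp only; split_ifs <;> positivity
  have hWmem : ∀ n ∈ s, ⌈zetaOrdinate n⌉₊ - 1 ∈ W := by
    intro n hn
    have h1 : ⌈zetaOrdinate n⌉₊ ≤ ⌈T⌉₊ := Nat.ceil_mono (hs n hn)
    have h2 : ⌈T⌉₊ ≤ Tf + 1 := Nat.ceil_le_floor_add_one T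
    rw [hW, Finset.mem_range]; omega
  have hgG : ∀ n ∈ s, φ n ≤ G (⌈zetaOrdinate n⌉₊ - 1) := by
    intro n hn
    obtain ⟨hw1, hw2⟩ := window_spec n
    rw [hG]; dsimp only
    split_ifs with hm
    · exact hφπ n
    · have hm1 : (1 : ℝ) ≤ ((⌈zetaOrdinate n⌉₊ - 1 : ℕ) : ℝ) := by
        exact_mod_cast Nat.one_le_iff_ne_zero.2 hm
      calc φ n ≤ 1 / zetaOrdinate n := pi_div_two_sub_arctan_le_inv (by linarith)
        _ ≤ 1 / ((⌈zetaOrdinate n⌉₊ - 1 : ℕ) : ℝ) := one_div_le_one_div_of_le (by linarith) hw1.le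
  have h1 := near_sum_le hA0 hA s W Tf (fun m hm ↦ by rw [hW, Finset.mem_range] at hm; omega)
    hWmem φ G (fun m _ ↦ hG0 m) hgG
  have h3 : ∑ m ∈ W, G m ≤ π + (1 + Real.log (Tf : ℝ)) := by
    rw [hW, Finset.sum_range_succ']
    have e0 : G 0 = π := by rw [hG]; dsimp only; rw [if_pos rfl]
    have e1 : ∀ m : ℕ, G (m + 1) = 1 / ((m : ℝ) + 1) := fun m ↦ by
      rw [hG]; dsimp only; rw [if_neg (by omega)]; push_cast; ring
    simp only [e0, e1]
    linarith [sum_range_one_div_succ_le_log Tf]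
  have hlogTf : Real.log ((Tf : ℝ) + 2) ≤ L := Real.log_le_log (by positivity) (by linarith)
  calc ∑ n ∈ s, φ n ≤ A * Real.log ((Tf : ℝ) + 2) * ∑ m ∈ W, G m := h1
    _ ≤ A * L * (π + (1 + Real.log (Tf : ℝ))) := by
        apply mul_le_mul (mul_le_mul_of_nonneg_left hlogTf hA0.le) h3
          (Finset.sum_nonneg fun m _ ↦ hG0 m) (by positivity)
    _ ≤ A * L * (7 * L) := by
        apply mul_le_mul_of_nonneg_left _ (by positivity)
        linarith [Real.pi_lt_d2]
    _ = 7 * A * L ^ 2 := by ring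


/-! ## A derivative -/

/-- Derivative of `t ↦ arctan (t − c)`. [folklore] -/
theorem hasDerivAt_arctan_sub (c t : ℝ) :
    HasDerivAt (fun t ↦ Real.arctan (t - c)) (1 / (1 + (t - c) ^ 2)) t :=
  HasDerivAt.comp_sub_const t c (Real.hasDerivAt_arctan (t - c))

/-! ## The two halves of Montgomery's summand and the truncated sum `S₁` -/

/-- Norm of the first half `x^{iγ_n}/(1+(t−γ_n)²)` of Montgomery's summand. [folklore] -/
theorem norm_firstHalf {x : ℝ} (hx : 0 < x) (t : ℝ) (n : ℕ) :
    ‖(x : ℂ) ^ ((zetaOrdinate n : ℂ) * I) / ((1 + (t - zetaOrdinate n) ^ 2 : ℝ) : ℂ)‖ =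
      1 / (1 + (t - zetaOrdinate n) ^ 2) := by
  rw [norm_div, norm_cpow_eq_rpow_re_of_pos hx, Complex.norm_real, Real.norm_of_nonneg (by positivity)]
  simp

/-- Norm of the second half `x^{-iγ_n}/(1+(t+γ_n)²)` of Montgomery's summand. [folklore] -/
theorem norm_secondHalf {x : ℝ} (hx : 0 < x) (t : ℝ) (n : ℕ) :
    ‖(x : ℂ) ^ (-((zetaOrdinate n : ℂ) * I)) / ((1 + (t + zetaOrdinate n) ^ 2 : ℝ) : ℂ)‖ =
      1 / (1 + (t + zetaOrdinate n) ^ 2) := by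
  have : -((zetaOrdinate n : ℂ) * I) = ((-zetaOrdinate n : ℝ) : ℂ) * I := by push_cast; ring
  rw [norm_div, this, norm_cpow_eq_rpow_re_of_pos hx, Complex.norm_real,
    Real.norm_of_nonneg (by positivity)]
  simp

/-- `1/(1+(t+γ_n)²) ≤ 1/(1+(t−γ_n)²)` for `t ≥ 0` (`γ_n > 0`). [folklore] -/
theorem secondWeight_le_firstWeight {t : ℝ} (ht : 0 ≤ t) (n : ℕ) :
    1 / (1 + (t + zetaOrdinate n) ^ 2) ≤ 1 / (1 + (t - zetaOrdinate n) ^ 2) := by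
  have hγ := zetaOrdinate_pos_holds n
  apply one_div_le_one_div_of_le (by positivity)
  nlinarith

/-- Summability of `n ↦ 1/(1+(t−γ_n)²)`. [folklore] -/
theorem summable_firstWeight (t : ℝ) :
    Summable fun n : ℕ ↦ 1 / (1 + (t - zetaOrdinate n) ^ 2) := by
  obtain ⟨A₁, -, hA₁⟩ := exists_density_le
  exact (hA₁ t).1

/-- Summability of `n ↦ 1/(1+(t+γ_n)²)` (the density series at `−t`). [folklore] -/
theorem summable_secondWeight (t : ℝ) :
    Summable fun n : ℕ ↦ 1 / (1 + (t + zetaOrdinate n) ^ 2) := by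
  refine (summable_firstWeight (-t)).congr fun n ↦ ?_
  ring_nf

/-- Summability of the majorant `r_n(t) = [n ≥ N]/(1+(t−γ_n)²) + 1/(1+(t+γ_n)²)` of `S − S₁`. [folklore] -/
theorem summable_tailWeight (N : ℕ) (t : ℝ) :
    Summable fun n : ℕ ↦ (if n < N then 0 else 1 / (1 + (t - zetaOrdinate n) ^ 2)) +
      1 / (1 + (t + zetaOrdinate n) ^ 2) := by
  refine Summable.add ?_ (summable_secondWeight t)
  refine (summable_firstWeight t).of_nonneg_of_le (fun n ↦ ?_) fun n ↦ ?_
  · split_ifs <;> positivity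
  · split_ifs <;> [positivity; exact le_rfl]

/-- **`S − S₁` is small**: for `x > 0`, with `S₁(t) = ∑_{n < N(T)} x^{iγ_n}/(1+(t−γ_n)²)` the part of
Montgomery's sum over the zeros `0 < γ ≤ T`,
`‖S(x,t) − S₁(t)‖ ≤ ∑_n ([n ≥ N(T)]/(1+(t−γ_n)²) + 1/(1+(t+γ_n)²))`. [folklore] -/
theorem norm_zeroSum_sub_partial_le {x : ℝ} (hx : 0 < x) (T t : ℝ) :
    ‖montgomeryZeroSum x t - ∑ n ∈ Finset.range (zetaZeroCount T),
        (x : ℂ) ^ ((zetaOrdinate n : ℂ) * I) / ((1 + (t - zetaOrdinate n) ^ 2 : ℝ) : ℂ)‖ ≤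
      ∑' n : ℕ, ((if n < zetaZeroCount T then 0 else 1 / (1 + (t - zetaOrdinate n) ^ 2)) +
        1 / (1 + (t + zetaOrdinate n) ^ 2)) := by
  set N := zetaZeroCount T with hN
  set e : ℕ → ℂ := fun n ↦ (x : ℂ) ^ ((zetaOrdinate n : ℂ) * I) /
    ((1 + (t - zetaOrdinate n) ^ 2 : ℝ) : ℂ) with he
  have hS : HasSum (montgomeryZeroSummand x t) (montgomeryZeroSum x t) :=
    (summable_montgomeryZeroSummand hx t).hasSum
  have hS₁ : HasSum (fun n ↦ if n < N then e n else 0) (∑ n ∈ Finset.range N, e n) := by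
    have h : HasSum (fun n ↦ if n < N then e n else 0)
        (∑ n ∈ Finset.range N, if n < N then e n else 0) :=
      hasSum_sum_of_ne_finset_zero fun n hn ↦ by
        rw [Finset.mem_range] at hn; exact if_neg hn
    rwa [Finset.sum_congr rfl fun n hn ↦ if_pos (Finset.mem_range.1 hn)] at h
  have hsub := hS.sub hS₁
  refine hsub.norm_le_of_bounded (summable_tailWeight N t).hasSum fun n ↦ ?_
  have hdef : montgomeryZeroSummand x t n = e n +
      (x : ℂ) ^ (-((zetaOrdinate n : ℂ) * I)) / ((1 + (t + zetaOrdinate n) ^ 2 : ℝ) : ℂ) := rfl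
  rw [hdef]
  split_ifs with hn
  · rw [add_sub_cancel_left, norm_secondHalf hx, zero_add]
  · rw [sub_zero]
    refine (norm_add_le _ _).trans ?_
    rw [he, norm_firstHalf hx, norm_secondHalf hx]

/-- `‖S(x,t)‖ ≤ 2 D(t)` for `t ≥ 0`, where `D(t) = ∑_n 1/(1+(t−γ_n)²)`. [folklore] -/
theorem norm_zeroSum_le {x : ℝ} (hx : 0 < x) {t : ℝ} (ht : 0 ≤ t) :
    ‖montgomeryZeroSum x t‖ ≤ 2 * ∑' n : ℕ, 1 / (1 + (t - zetaOrdinate n) ^ 2) := by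
  have h1 : ‖montgomeryZeroSum x t‖ ≤ ∑' n : ℕ, (1 / (1 + (t - zetaOrdinate n) ^ 2) +
      1 / (1 + (t - zetaOrdinate n) ^ 2)) := by
    refine (summable_montgomeryZeroSummand hx t).hasSum.norm_le_of_bounded
      ((summable_firstWeight t).add (summable_firstWeight t)).hasSum fun n ↦ ?_
    refine (norm_add_le _ _).trans (add_le_add ?_ ?_)
    · rw [norm_firstHalf hx]
    · rw [norm_secondHalf hx]; exact secondWeight_le_firstWeight ht n
  refine h1.trans_eq ?_
  rw [(summable_firstWeight t).tsum_add (summable_firstWeight t)]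
  ring

/-- `‖S₁(t)‖ ≤ D(t)`. [folklore] -/
theorem norm_partial_le {x : ℝ} (hx : 0 < x) (T t : ℝ) :
    ‖∑ n ∈ Finset.range (zetaZeroCount T),
        (x : ℂ) ^ ((zetaOrdinate n : ℂ) * I) / ((1 + (t - zetaOrdinate n) ^ 2 : ℝ) : ℂ)‖ ≤
      ∑' n : ℕ, 1 / (1 + (t - zetaOrdinate n) ^ 2) := by
  refine (norm_sum_le _ _).trans ?_
  simp_rw [norm_firstHalf hx]
  exact (summable_firstWeight t).sum_le_tsum _ fun n _ ↦ by positivity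

/-- `‖S₁(t)‖ ≤ ∑_{n<N(T)} 1/(1+(t−γ_n)²)` (the finite majorant). [folklore] -/
theorem norm_partial_le_sum {x : ℝ} (hx : 0 < x) (T t : ℝ) :
    ‖∑ n ∈ Finset.range (zetaZeroCount T),
        (x : ℂ) ^ ((zetaOrdinate n : ℂ) * I) / ((1 + (t - zetaOrdinate n) ^ 2 : ℝ) : ℂ)‖ ≤
      ∑ n ∈ Finset.range (zetaZeroCount T), 1 / (1 + (t - zetaOrdinate n) ^ 2) := by
  refine (norm_sum_le _ _).trans_eq ?_
  simp_rw [norm_firstHalf hx]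

/-- **Pointwise comparison of `|S|²` and `|S₁|²`** on `t ≥ 0`:
`|‖S‖² − ‖S₁‖²| ≤ 3 D(t) · R(t)` with `R` the majorant of `‖S − S₁‖`. [folklore] -/
theorem abs_norm_sq_sub_norm_sq_le {x : ℝ} (hx : 0 < x) (T : ℝ) {t : ℝ} (ht : 0 ≤ t) :
    |‖montgomeryZeroSum x t‖ ^ 2 - ‖∑ n ∈ Finset.range (zetaZeroCount T),
        (x : ℂ) ^ ((zetaOrdinate n : ℂ) * I) / ((1 + (t - zetaOrdinate n) ^ 2 : ℝ) : ℂ)‖ ^ 2| ≤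
      3 * (∑' n : ℕ, 1 / (1 + (t - zetaOrdinate n) ^ 2)) *
        ∑' n : ℕ, ((if n < zetaZeroCount T then 0 else 1 / (1 + (t - zetaOrdinate n) ^ 2)) +
          1 / (1 + (t + zetaOrdinate n) ^ 2)) := by
  set S := montgomeryZeroSum x t
  set S₁ := ∑ n ∈ Finset.range (zetaZeroCount T),
        (x : ℂ) ^ ((zetaOrdinate n : ℂ) * I) / ((1 + (t - zetaOrdinate n) ^ 2 : ℝ) : ℂ)
  set D := ∑' n : ℕ, 1 / (1 + (t - zetaOrdinate n) ^ 2)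
  set R := ∑' n : ℕ, ((if n < zetaZeroCount T then 0 else 1 / (1 + (t - zetaOrdinate n) ^ 2)) +
          1 / (1 + (t + zetaOrdinate n) ^ 2))
  have hD : ‖S₁‖ ≤ D := norm_partial_le hx T t
  have hS : ‖S‖ ≤ 2 * D := norm_zeroSum_le hx ht
  have hR : ‖S - S₁‖ ≤ R := norm_zeroSum_sub_partial_le hx T t
  have h1 : |‖S‖ - ‖S₁‖| ≤ R := (abs_norm_sub_norm_le S S₁).trans hR
  have h2 : ‖S‖ ^ 2 - ‖S₁‖ ^ 2 = (‖S‖ - ‖S₁‖) * (‖S‖ + ‖S₁‖) := by ring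
  rw [h2, abs_mul, abs_of_nonneg (by positivity : 0 ≤ ‖S‖ + ‖S₁‖)]
  have hR0 : 0 ≤ R := le_trans (abs_nonneg _) h1
  calc |‖S‖ - ‖S₁‖| * (‖S‖ + ‖S₁‖) ≤ R * (2 * D + D) := by
        apply mul_le_mul h1 (add_le_add hS hD) (by positivity) hR0
    _ = 3 * D * R := by ring


/-! ## The majorant `R` of `S − S₁`: continuity and `∫_0^T R ≪ log²(T+2)` -/

/-- `1/(1+(t−δ)²) ≤ 2(1+M²)/(1+δ²)` for `|t| ≤ M`. [folklore] -/
theorem one_div_one_add_sq_sub_le_of_abs_le {t M : ℝ} (ht : |t| ≤ M) (δ : ℝ) :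
    1 / (1 + (t - δ) ^ 2) ≤ 2 * (1 + M ^ 2) / (1 + δ ^ 2) := by
  have hM : t ^ 2 ≤ M ^ 2 := sq_le_sq.2 (ht.trans (le_abs_self M))
  rw [div_le_div_iff₀ (by positivity) (by positivity)]
  nlinarith [sq_nonneg (t - δ + t), sq_nonneg (t - δ), sq_nonneg t, sq_nonneg δ,
    mul_nonneg (sq_nonneg (t - δ)) (sq_nonneg t)]

/-- Continuity of `t ↦ 1/(1+(t−δ)²)`. [folklore] -/
theorem continuous_firstWeight (δ : ℝ) : Continuous fun t : ℝ ↦ 1 / (1 + (t - δ) ^ 2) :=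
  continuous_one_div_one_add_sq.comp (continuous_id.sub continuous_const)

/-- Continuity of `t ↦ 1/(1+(t+δ)²)`. [folklore] -/
theorem continuous_secondWeight (δ : ℝ) : Continuous fun t : ℝ ↦ 1 / (1 + (t + δ) ^ 2) :=
  continuous_one_div_one_add_sq.comp (continuous_id.add continuous_const)

/-- Continuity of the terms `r_n` of the majorant. [folklore] -/
theorem continuous_tailWeight (N n : ℕ) : Continuous fun t : ℝ ↦
    (if n < N then 0 else 1 / (1 + (t - zetaOrdinate n) ^ 2)) +
      1 / (1 + (t + zetaOrdinate n) ^ 2) := by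
  refine Continuous.add ?_ (continuous_secondWeight _)
  split_ifs
  · exact continuous_const
  · exact continuous_firstWeight _

/-- The majorant `R(t) = ∑_n r_n(t)` is continuous on `[−M, M]` (locally uniform convergence). [folklore] -/
theorem continuousOn_tailSum (N : ℕ) (M : ℝ) : ContinuousOn (fun t ↦ ∑' n : ℕ,
    ((if n < N then 0 else 1 / (1 + (t - zetaOrdinate n) ^ 2)) +
      1 / (1 + (t + zetaOrdinate n) ^ 2))) (Icc (-M) M) := by
  refine continuousOn_tsum (fun n ↦ (continuous_tailWeight N n).continuousOn)
    ((summable_one_div_one_add_zetaOrdinate_sq.mul_left (2 * (1 + M ^ 2))).add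
      (summable_one_div_one_add_zetaOrdinate_sq.mul_left (2 * (1 + M ^ 2)))) fun n t ht ↦ ?_
  have htM : |t| ≤ M := abs_le.2 ⟨ht.1, ht.2⟩
  rw [Real.norm_of_nonneg (by positivity)]
  refine add_le_add ?_ ?_
  · split_ifs
    · positivity
    · rw [mul_one_div]; exact one_div_one_add_sq_sub_le_of_abs_le htM _
  · rw [mul_one_div]
    have := one_div_one_add_sq_sub_le_of_abs_le htM (-zetaOrdinate n)
    rwa [sub_neg_eq_add, neg_sq] at this

/-- **`∫_0^T R(t) dt ≪ log²(T+2)`** (Goldston 2005, between (4.2) and (4.3); Montgomery 1973, §3):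
integrating the majorant termwise (`∫_0^T dt/(1+(t−γ)²) = arctan γ − arctan(γ−T)`,
`∫_0^T dt/(1+(t+γ)²) = arctan(T+γ) − arctan γ`) and summing with (Za), (Zb). [cite: Goldston2005, (4.3)] -/
theorem exists_integral_tailSum_le :
    ∃ B₂ : ℝ, 0 < B₂ ∧ ∀ T : ℝ, 2 ≤ T →
      IntervalIntegrable (fun t ↦ ∑' n : ℕ, ((if n < zetaZeroCount T then 0 else
        1 / (1 + (t - zetaOrdinate n) ^ 2)) + 1 / (1 + (t + zetaOrdinate n) ^ 2))) volume 0 T ∧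
      ∫ t in (0 : ℝ)..T, ∑' n : ℕ, ((if n < zetaZeroCount T then 0 else
        1 / (1 + (t - zetaOrdinate n) ^ 2)) + 1 / (1 + (t + zetaOrdinate n) ^ 2)) ≤
        B₂ * Real.log (T + 2) ^ 2 := by
  obtain ⟨Ba, hBa0, hBa⟩ := exists_sum_arctan_sub_arctan_sub_le
  obtain ⟨Bb, hBb0, hBb⟩ := exists_sum_arctan_add_sub_arctan_le
  refine ⟨Ba + Bb, by positivity, fun T hT ↦ ?_⟩
  set N := zetaZeroCount T with hN
  set r : ℕ → ℝ → ℝ := fun n t ↦ (if n < N then 0 else 1 / (1 + (t - zetaOrdinate n) ^ 2)) +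
    1 / (1 + (t + zetaOrdinate n) ^ 2) with hr
  have hT0 : (0 : ℝ) ≤ T := by linarith
  have hcont : ContinuousOn (fun t ↦ ∑' n, r n t) (Icc (-T) T) := continuousOn_tailSum N T
  have hint : IntervalIntegrable (fun t ↦ ∑' n, r n t) volume 0 T := by
    refine (hcont.mono ?_).intervalIntegrable
    rw [uIcc_of_le hT0]
    exact Icc_subset_Icc (by linarith) le_rfl
  refine ⟨hint, ?_⟩
  have hterm : ∀ n, ∫ t in (0 : ℝ)..T, r n t = (if n < N then 0 else
      Real.arctan (zetaOrdinate n) - Real.arctan (zetaOrdinate n - T)) +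
      (Real.arctan (T + zetaOrdinate n) - Real.arctan (zetaOrdinate n)) := by
    intro n
    have hp : ∫ t in (0 : ℝ)..T, 1 / (1 + (t - zetaOrdinate n) ^ 2) =
        Real.arctan (zetaOrdinate n) - Real.arctan (zetaOrdinate n - T) := by
      rw [intervalIntegral.integral_comp_sub_right (fun u : ℝ ↦ 1 / (1 + u ^ 2)),
        integral_one_div_one_add_sq, zero_sub, Real.arctan_neg,
        show T - zetaOrdinate n = -(zetaOrdinate n - T) by ring, Real.arctan_neg]
      ring
    have hq : ∫ t in (0 : ℝ)..T, 1 / (1 + (t + zetaOrdinate n) ^ 2) =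
        Real.arctan (T + zetaOrdinate n) - Real.arctan (zetaOrdinate n) := by
      rw [intervalIntegral.integral_comp_add_right (fun u : ℝ ↦ 1 / (1 + u ^ 2)),
        integral_one_div_one_add_sq, zero_add]
    rw [hr]
    dsimp only
    rw [intervalIntegral.integral_add ?_ ((continuous_secondWeight _).intervalIntegrable _ _), hq]
    · congr 1
      split_ifs with hn
      · simp
      · exact hp
    · split_ifs
      · exact intervalIntegrable_const
      · exact (continuous_firstWeight _).intervalIntegrable _ _
  have hsum : HasSum (fun n ↦ ∫ t in (0 : ℝ)..T, r n t) (∫ t in (0 : ℝ)..T, ∑' n, r n t) := by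
    refine intervalIntegral.hasSum_integral_of_dominated_convergence r
      (fun n ↦ (continuous_tailWeight N n).aestronglyMeasurable)
      (fun n ↦ ae_of_all _ fun t _ ↦ ?_)
      (ae_of_all _ fun t _ ↦ summable_tailWeight N t) hint
      (ae_of_all _ fun t _ ↦ (summable_tailWeight N t).hasSum)
    rw [Real.norm_of_nonneg (by positivity)]
  refine hasSum_le_of_sum_le hsum fun s ↦ ?_
  simp only [hterm, Finset.sum_add_distrib, Finset.sum_ite, Finset.sum_const_zero, zero_add]
  have h1 : ∑ n ∈ s.filter (fun n ↦ ¬ n < N), (Real.arctan (zetaOrdinate n) -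
      Real.arctan (zetaOrdinate n - T)) ≤ Ba * Real.log (T + 2) ^ 2 :=
    hBa T hT _ fun n hn ↦ by
      rw [Finset.mem_filter] at hn
      exact not_le.1 fun h ↦ hn.2 (zetaOrdinate_le_iff_lt.1 h)
  have h2 := hBb T hT s
  linarith


/-! ## `S₁`: continuity, integrability, and the tails of `∫ |S₁|²` off `[0, T]` -/

/-- Integrability of `t ↦ 1/(1+(t−δ)²)` on `ℝ`. [folklore] -/
theorem integrable_firstWeight (δ : ℝ) : Integrable fun t : ℝ ↦ 1 / (1 + (t - δ) ^ 2) := by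
  simpa [one_div] using integrable_inv_one_add_sq.comp_sub_right δ

/-- `S₁` is continuous in `t`. [folklore] -/
theorem continuous_partial (x T : ℝ) : Continuous fun t : ℝ ↦
    ∑ n ∈ Finset.range (zetaZeroCount T),
      (x : ℂ) ^ ((zetaOrdinate n : ℂ) * I) / ((1 + (t - zetaOrdinate n) ^ 2 : ℝ) : ℂ) := by
  refine continuous_finsetSum _ fun n _ ↦ continuous_const.div (by fun_prop) fun t ↦ ?_
  exact_mod_cast (by positivity : (1 + (t - zetaOrdinate n) ^ 2 : ℝ) ≠ 0)

/-- `‖S₁(t)‖² ≤ N(T) ∑_{n<N(T)} 1/(1+(t−γ_n)²)`. [folklore] -/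
theorem norm_partial_sq_le_mul_sum {x : ℝ} (hx : 0 < x) (T t : ℝ) :
    ‖∑ n ∈ Finset.range (zetaZeroCount T),
        (x : ℂ) ^ ((zetaOrdinate n : ℂ) * I) / ((1 + (t - zetaOrdinate n) ^ 2 : ℝ) : ℂ)‖ ^ 2 ≤
      (zetaZeroCount T : ℝ) * ∑ n ∈ Finset.range (zetaZeroCount T), 1 / (1 + (t - zetaOrdinate n) ^ 2) := by
  have h1 := norm_partial_le_sum hx T t
  have h2 : ∑ n ∈ Finset.range (zetaZeroCount T), 1 / (1 + (t - zetaOrdinate n) ^ 2) ≤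
      (zetaZeroCount T : ℝ) := by
    calc ∑ n ∈ Finset.range (zetaZeroCount T), 1 / (1 + (t - zetaOrdinate n) ^ 2)
        ≤ ∑ n ∈ Finset.range (zetaZeroCount T), (1 : ℝ) := by
          refine Finset.sum_le_sum fun n _ ↦ ?_
          rw [div_le_one (by positivity)]; nlinarith [sq_nonneg (t - zetaOrdinate n)]
      _ = zetaZeroCount T := by simp
  have h0 : 0 ≤ ∑ n ∈ Finset.range (zetaZeroCount T), 1 / (1 + (t - zetaOrdinate n) ^ 2) :=
    Finset.sum_nonneg fun n _ ↦ by positivity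
  calc _ = ‖∑ n ∈ Finset.range (zetaZeroCount T),
        (x : ℂ) ^ ((zetaOrdinate n : ℂ) * I) / ((1 + (t - zetaOrdinate n) ^ 2 : ℝ) : ℂ)‖ *
        ‖∑ n ∈ Finset.range (zetaZeroCount T),
        (x : ℂ) ^ ((zetaOrdinate n : ℂ) * I) / ((1 + (t - zetaOrdinate n) ^ 2 : ℝ) : ℂ)‖ := sq _
    _ ≤ (zetaZeroCount T : ℝ) * ∑ n ∈ Finset.range (zetaZeroCount T), 1 / (1 + (t - zetaOrdinate n) ^ 2) :=
        mul_le_mul (h1.trans h2) h1 (norm_nonneg _) (Nat.cast_nonneg _)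

/-- `t ↦ ‖S₁(t)‖²` is integrable on `ℝ`. [folklore] -/
theorem integrable_norm_partial_sq {x : ℝ} (hx : 0 < x) (T : ℝ) :
    Integrable fun t : ℝ ↦ ‖∑ n ∈ Finset.range (zetaZeroCount T),
      (x : ℂ) ^ ((zetaOrdinate n : ℂ) * I) / ((1 + (t - zetaOrdinate n) ^ 2 : ℝ) : ℂ)‖ ^ 2 := by
  have h1 : Integrable fun t : ℝ ↦ ∑ n ∈ Finset.range (zetaZeroCount T),
      1 / (1 + (t - zetaOrdinate n) ^ 2) :=
    integrable_finsetSum _ fun n _ ↦ integrable_firstWeight (zetaOrdinate n)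
  refine (h1.const_mul (zetaZeroCount T : ℝ)).mono'
    ((continuous_partial x T).norm.pow 2).aestronglyMeasurable (ae_of_all _ fun t ↦ ?_)
  rw [Real.norm_of_nonneg (by positivity)]
  exact norm_partial_sq_le_mul_sum hx T t

/-- `∫_T^∞ dt/(1+(t−δ)²) = π/2 − arctan(T − δ)`. [folklore] -/
theorem integral_Ioi_firstWeight (T δ : ℝ) :
    ∫ t in Ioi T, 1 / (1 + (t - δ) ^ 2) = π / 2 - Real.arctan (T - δ) := by
  have htend : Tendsto (fun t : ℝ ↦ Real.arctan (t - δ)) atTop (𝓝 (π / 2)) :=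
    (Real.tendsto_arctan_atTop.mono_right nhdsWithin_le_nhds).comp
      (tendsto_atTop_add_const_right _ (-δ) tendsto_id)
  rw [integral_Ioi_of_hasDerivAt_of_tendsto' (fun t _ ↦ hasDerivAt_arctan_sub δ t)
    (integrable_firstWeight δ).integrableOn htend]

/-- `∫_{-∞}^0 dt/(1+(t−δ)²) = π/2 − arctan δ`. [folklore] -/
theorem integral_Iic_firstWeight (δ : ℝ) :
    ∫ t in Iic (0 : ℝ), 1 / (1 + (t - δ) ^ 2) = π / 2 - Real.arctan δ := by
  have htend : Tendsto (fun t : ℝ ↦ Real.arctan (t - δ)) atBot (𝓝 (-(π / 2))) :=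
    (Real.tendsto_arctan_atBot.mono_right nhdsWithin_le_nhds).comp
      (tendsto_atBot_add_const_right _ (-δ) tendsto_id)
  rw [integral_Iic_of_hasDerivAt_of_tendsto' (fun t _ ↦ hasDerivAt_arctan_sub δ t)
    (integrable_firstWeight δ).integrableOn htend, zero_sub, Real.arctan_neg]
  ring

/-- **Right tail**: `∫_T^∞ |S₁(t)|² dt ≪ log³(T+2)` (`T ≥ 2`, uniformly in `x > 0`): for `t ≥ T`,
`|S₁(t)| ≤ ∑_{γ≤T} 1/(1+(t−γ)²) ≤ D(T) ≪ log(T+2)`, and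
`∫_T^∞ ∑_{γ ≤ T} dt/(1+(t−γ)²) = ∑_{γ≤T} (π/2 − arctan(T−γ)) ≪ log²(T+2)` by (Zc).
(Goldston 2005, before (4.3): "we may extend the integration range to `(−∞, ∞)` with a small
error".) [cite: Goldston2005, (4.3)] -/
theorem exists_integral_Ioi_norm_partial_sq_le :
    ∃ B₃ : ℝ, 0 < B₃ ∧ ∀ x : ℝ, 0 < x → ∀ T : ℝ, 2 ≤ T →
      ∫ t in Ioi T, ‖∑ n ∈ Finset.range (zetaZeroCount T),
        (x : ℂ) ^ ((zetaOrdinate n : ℂ) * I) / ((1 + (t - zetaOrdinate n) ^ 2 : ℝ) : ℂ)‖ ^ 2 ≤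
        B₃ * Real.log (T + 2) ^ 3 := by
  obtain ⟨A₁, hA₁0, hA₁⟩ := exists_density_le
  obtain ⟨Bc, hBc0, hBc⟩ := exists_sum_pi_div_two_sub_arctan_sub_le
  refine ⟨A₁ * Bc, by positivity, fun x hx T hT ↦ ?_⟩
  set N := zetaZeroCount T with hN
  have hT0 : 0 ≤ T := by linarith
  have hDT := (hA₁ T).2
  rw [abs_of_nonneg hT0] at hDT
  set D := ∑' n : ℕ, 1 / (1 + (T - zetaOrdinate n) ^ 2) with hD
  have hD0 : 0 ≤ D := tsum_nonneg fun n ↦ by positivity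
  -- pointwise on `Ioi T`
  have hpt : ∀ t ∈ Ioi T, ‖∑ n ∈ Finset.range N,
      (x : ℂ) ^ ((zetaOrdinate n : ℂ) * I) / ((1 + (t - zetaOrdinate n) ^ 2 : ℝ) : ℂ)‖ ^ 2 ≤
      D * ∑ n ∈ Finset.range N, 1 / (1 + (t - zetaOrdinate n) ^ 2) := by
    intro t ht
    have h1 := norm_partial_le_sum hx T t
    have h2 : ∑ n ∈ Finset.range N, 1 / (1 + (t - zetaOrdinate n) ^ 2) ≤ D := by
      calc ∑ n ∈ Finset.range N, 1 / (1 + (t - zetaOrdinate n) ^ 2)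
          ≤ ∑ n ∈ Finset.range N, 1 / (1 + (T - zetaOrdinate n) ^ 2) := by
            refine Finset.sum_le_sum fun n hn ↦ ?_
            have hγ : zetaOrdinate n ≤ T := zetaOrdinate_le_iff_lt.2 (Finset.mem_range.1 hn)
            apply one_div_le_one_div_of_le (by positivity)
            have : T < t := ht
            nlinarith
        _ ≤ D := (summable_firstWeight T).sum_le_tsum _ fun n _ ↦ by positivity
    have h0 : 0 ≤ ∑ n ∈ Finset.range N, 1 / (1 + (t - zetaOrdinate n) ^ 2) :=
      Finset.sum_nonneg fun n _ ↦ by positivity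
    calc _ = ‖∑ n ∈ Finset.range N,
          (x : ℂ) ^ ((zetaOrdinate n : ℂ) * I) / ((1 + (t - zetaOrdinate n) ^ 2 : ℝ) : ℂ)‖ *
          ‖∑ n ∈ Finset.range N,
          (x : ℂ) ^ ((zetaOrdinate n : ℂ) * I) / ((1 + (t - zetaOrdinate n) ^ 2 : ℝ) : ℂ)‖ := sq _
      _ ≤ D * ∑ n ∈ Finset.range N, 1 / (1 + (t - zetaOrdinate n) ^ 2) :=
          mul_le_mul (h1.trans h2) h1 (norm_nonneg _) hD0
  have hint : Integrable fun t : ℝ ↦ D * ∑ n ∈ Finset.range N, 1 / (1 + (t - zetaOrdinate n) ^ 2) := by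
    have h1 : Integrable fun t : ℝ ↦ ∑ n ∈ Finset.range N, 1 / (1 + (t - zetaOrdinate n) ^ 2) :=
      integrable_finsetSum _ fun n _ ↦ integrable_firstWeight (zetaOrdinate n)
    exact h1.const_mul D
  calc ∫ t in Ioi T, ‖∑ n ∈ Finset.range N,
        (x : ℂ) ^ ((zetaOrdinate n : ℂ) * I) / ((1 + (t - zetaOrdinate n) ^ 2 : ℝ) : ℂ)‖ ^ 2
      ≤ ∫ t in Ioi T, D * ∑ n ∈ Finset.range N, 1 / (1 + (t - zetaOrdinate n) ^ 2) :=
        setIntegral_mono_on (integrable_norm_partial_sq hx T).integrableOn hint.integrableOn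
          measurableSet_Ioi hpt
    _ = D * ∑ n ∈ Finset.range N, (π / 2 - Real.arctan (T - zetaOrdinate n)) := by
        rw [MeasureTheory.integral_const_mul, integral_finsetSum _ fun n _ ↦
          (integrable_firstWeight _).integrableOn]
        simp_rw [integral_Ioi_firstWeight]
    _ ≤ (A₁ * Real.log (T + 2)) * (Bc * Real.log (T + 2) ^ 2) := by
        refine mul_le_mul hDT (hBc T hT _ fun n hn ↦ ?_) (Finset.sum_nonneg fun n _ ↦
          (pi_div_two_sub_arctan_mem _).1.le) (mul_nonneg hA₁0.le (Real.log_nonneg (by linarith)))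
        exact zetaOrdinate_le_iff_lt.2 (Finset.mem_range.1 hn)
    _ = A₁ * Bc * Real.log (T + 2) ^ 3 := by ring

/-- **Left tail**: `∫_{-∞}^0 |S₁(t)|² dt ≪ log²(T+2)`: for `t ≤ 0`,
`|S₁(t)| ≤ ∑_{γ ≤ T} 1/(1+(t−γ)²) ≤ D(0) ≪ 1`, and
`∫_{-∞}^0 ∑_{γ≤T} dt/(1+(t−γ)²) = ∑_{γ ≤ T} (π/2 − arctan γ) ≪ log²(T+2)` by (Zd). [cite: Goldston2005, (4.3)] -/
theorem exists_integral_Iic_norm_partial_sq_le :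
    ∃ B₄ : ℝ, 0 < B₄ ∧ ∀ x : ℝ, 0 < x → ∀ T : ℝ, 2 ≤ T →
      ∫ t in Iic (0 : ℝ), ‖∑ n ∈ Finset.range (zetaZeroCount T),
        (x : ℂ) ^ ((zetaOrdinate n : ℂ) * I) / ((1 + (t - zetaOrdinate n) ^ 2 : ℝ) : ℂ)‖ ^ 2 ≤
        B₄ * Real.log (T + 2) ^ 2 := by
  obtain ⟨A₁, hA₁0, hA₁⟩ := exists_density_le
  obtain ⟨Bd, hBd0, hBd⟩ := exists_sum_pi_div_two_sub_arctan_le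
  refine ⟨A₁ * Real.log 2 * Bd, mul_pos (mul_pos hA₁0 (Real.log_pos one_lt_two)) hBd0,
    fun x hx T hT ↦ ?_⟩
  set N := zetaZeroCount T with hN
  have hD0' := (hA₁ 0).2
  rw [abs_zero, zero_add] at hD0'
  set D := ∑' n : ℕ, 1 / (1 + (0 - zetaOrdinate n) ^ 2) with hD
  have hD0 : 0 ≤ D := tsum_nonneg fun n ↦ by positivity
  have hpt : ∀ t ∈ Iic (0 : ℝ), ‖∑ n ∈ Finset.range N,
      (x : ℂ) ^ ((zetaOrdinate n : ℂ) * I) / ((1 + (t - zetaOrdinate n) ^ 2 : ℝ) : ℂ)‖ ^ 2 ≤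
      D * ∑ n ∈ Finset.range N, 1 / (1 + (t - zetaOrdinate n) ^ 2) := by
    intro t ht
    have ht0 : t ≤ 0 := ht
    have h1 := norm_partial_le_sum hx T t
    have h2 : ∑ n ∈ Finset.range N, 1 / (1 + (t - zetaOrdinate n) ^ 2) ≤ D := by
      calc ∑ n ∈ Finset.range N, 1 / (1 + (t - zetaOrdinate n) ^ 2)
          ≤ ∑ n ∈ Finset.range N, 1 / (1 + (0 - zetaOrdinate n) ^ 2) := by
            refine Finset.sum_le_sum fun n _ ↦ ?_
            have hγ := zetaOrdinate_pos_holds n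
            apply one_div_le_one_div_of_le (by positivity)
            nlinarith
        _ ≤ D := (summable_firstWeight 0).sum_le_tsum _ fun n _ ↦ by positivity
    calc _ = ‖∑ n ∈ Finset.range N,
          (x : ℂ) ^ ((zetaOrdinate n : ℂ) * I) / ((1 + (t - zetaOrdinate n) ^ 2 : ℝ) : ℂ)‖ *
          ‖∑ n ∈ Finset.range N,
          (x : ℂ) ^ ((zetaOrdinate n : ℂ) * I) / ((1 + (t - zetaOrdinate n) ^ 2 : ℝ) : ℂ)‖ := sq _
      _ ≤ D * ∑ n ∈ Finset.range N, 1 / (1 + (t - zetaOrdinate n) ^ 2) :=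
          mul_le_mul (h1.trans h2) h1 (norm_nonneg _) hD0
  have hint : Integrable fun t : ℝ ↦ D * ∑ n ∈ Finset.range N, 1 / (1 + (t - zetaOrdinate n) ^ 2) := by
    have h1 : Integrable fun t : ℝ ↦ ∑ n ∈ Finset.range N, 1 / (1 + (t - zetaOrdinate n) ^ 2) :=
      integrable_finsetSum _ fun n _ ↦ integrable_firstWeight (zetaOrdinate n)
    exact h1.const_mul D
  calc ∫ t in Iic (0 : ℝ), ‖∑ n ∈ Finset.range N,
        (x : ℂ) ^ ((zetaOrdinate n : ℂ) * I) / ((1 + (t - zetaOrdinate n) ^ 2 : ℝ) : ℂ)‖ ^ 2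
      ≤ ∫ t in Iic (0 : ℝ), D * ∑ n ∈ Finset.range N, 1 / (1 + (t - zetaOrdinate n) ^ 2) :=
        setIntegral_mono_on (integrable_norm_partial_sq hx T).integrableOn hint.integrableOn
          measurableSet_Iic hpt
    _ = D * ∑ n ∈ Finset.range N, (π / 2 - Real.arctan (zetaOrdinate n)) := by
        rw [MeasureTheory.integral_const_mul, integral_finsetSum _ fun n _ ↦
          (integrable_firstWeight _).integrableOn]
        simp_rw [integral_Iic_firstWeight]
    _ ≤ (A₁ * Real.log 2) * (Bd * Real.log (T + 2) ^ 2) := by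
        refine mul_le_mul hD0' (hBd T hT _ fun n hn ↦ ?_) (Finset.sum_nonneg fun n _ ↦
          (pi_div_two_sub_arctan_mem _).1.le) (mul_nonneg hA₁0.le (Real.log_pos one_lt_two).le)
        exact zetaOrdinate_le_iff_lt.2 (Finset.mem_range.1 hn)
    _ = A₁ * Real.log 2 * Bd * Real.log (T + 2) ^ 2 := by ring


/-! ## The `L²`-identity `∫ |S₁|² = (π/2) F(x, T)` -/

/-- The real part of `x^{iγ_n}/(1+(t−γ_n)²) · conj(x^{iγ_m}/(1+(t−γ_m)²))` is
`cos(log x (γ_n − γ_m)) / ((1+(t−γ_n)²)(1+(t−γ_m)²))` (`x > 0`). [folklore] -/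
theorem re_firstHalf_mul_conj {x : ℝ} (hx : 0 < x) (t : ℝ) (n m : ℕ) :
    ((x : ℂ) ^ ((zetaOrdinate n : ℂ) * I) / ((1 + (t - zetaOrdinate n) ^ 2 : ℝ) : ℂ) *
      (starRingEnd ℂ) ((x : ℂ) ^ ((zetaOrdinate m : ℂ) * I) /
        ((1 + (t - zetaOrdinate m) ^ 2 : ℝ) : ℂ))).re =
    Real.cos (Real.log x * (zetaOrdinate n - zetaOrdinate m)) *
      (1 / ((1 + (t - zetaOrdinate n) ^ 2) * (1 + (t - zetaOrdinate m) ^ 2))) := by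
  have hx0 : (x : ℂ) ≠ 0 := ofReal_ne_zero.2 hx.ne'
  have hc : ∀ y : ℝ, (x : ℂ) ^ ((y : ℂ) * I) = exp ((Real.log x * y : ℝ) * I) := fun y ↦ by
    rw [cpow_def_of_ne_zero hx0, ← ofReal_log hx.le]
    push_cast
    ring_nf
  rw [hc, hc, map_div₀, ← exp_conj, map_mul, conj_ofReal, conj_I, conj_ofReal, div_mul_div_comm,
    ← exp_add, ← ofReal_mul]
  have e : ((Real.log x * zetaOrdinate n : ℝ) : ℂ) * I + ((Real.log x * zetaOrdinate m : ℝ) : ℂ) * -I =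
      ((Real.log x * (zetaOrdinate n - zetaOrdinate m) : ℝ) : ℂ) * I := by
    push_cast; ring
  rw [e, div_ofReal_re, exp_ofReal_mul_I_re]
  ring

/-- **`|S₁(t)|²` expanded**: `|S₁(t)|² = ∑_{n,m<N(T)} cos(log x (γ_n − γ_m))/((1+(t−γ_n)²)(1+(t−γ_m)²))`
("multiplying out", Goldston 2005, before (4.1)). [cite: Goldston2005, (4.1)] -/
theorem norm_partial_sq_eq {x : ℝ} (hx : 0 < x) (T t : ℝ) :
    ‖∑ n ∈ Finset.range (zetaZeroCount T),
        (x : ℂ) ^ ((zetaOrdinate n : ℂ) * I) / ((1 + (t - zetaOrdinate n) ^ 2 : ℝ) : ℂ)‖ ^ 2 =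
      ∑ n ∈ Finset.range (zetaZeroCount T), ∑ m ∈ Finset.range (zetaZeroCount T),
        Real.cos (Real.log x * (zetaOrdinate n - zetaOrdinate m)) *
          (1 / ((1 + (t - zetaOrdinate n) ^ 2) * (1 + (t - zetaOrdinate m) ^ 2))) := by
  set a : ℕ → ℂ := fun n ↦ (x : ℂ) ^ ((zetaOrdinate n : ℂ) * I) /
    ((1 + (t - zetaOrdinate n) ^ 2 : ℝ) : ℂ) with ha
  have h1 : ‖∑ n ∈ Finset.range (zetaZeroCount T), a n‖ ^ 2 =
      ((∑ n ∈ Finset.range (zetaZeroCount T), a n) *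
        (starRingEnd ℂ) (∑ n ∈ Finset.range (zetaZeroCount T), a n)).re := by
    rw [mul_conj, ofReal_re, normSq_eq_norm_sq]
  rw [h1, map_sum, Finset.sum_mul_sum, re_sum]
  refine Finset.sum_congr rfl fun n _ ↦ ?_
  rw [re_sum]
  exact Finset.sum_congr rfl fun m _ ↦ re_firstHalf_mul_conj hx t n m

/-- **The `L²`-identity** (Goldston 2005, (4.1); Montgomery 1973, §3):
`∫_ℝ |∑_{0<γ≤T} x^{iγ}/(1+(t−γ)²)|² dt = (π/2) ∑_{0<γ,γ'≤T} x^{i(γ−γ')} w(γ−γ') = (π/2) F(x,T)`,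
from the expansion of `|S₁|²` and the Cauchy integral `integral_cauchyKernel_mul_cauchyKernel`
(`MontgomeryCauchyKernel.lean`).
[cite: Goldston2005, (4.1)] -/
theorem integral_norm_partial_sq {x : ℝ} (hx : 0 < x) (T : ℝ) :
    ∫ t : ℝ, ‖∑ n ∈ Finset.range (zetaZeroCount T),
        (x : ℂ) ^ ((zetaOrdinate n : ℂ) * I) / ((1 + (t - zetaOrdinate n) ^ 2 : ℝ) : ℂ)‖ ^ 2 =
      π / 2 * montgomeryPairSum x T := by
  simp_rw [norm_partial_sq_eq hx T]
  have hI : ∀ n m : ℕ, Integrable fun t : ℝ ↦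
      Real.cos (Real.log x * (zetaOrdinate n - zetaOrdinate m)) *
        (1 / ((1 + (t - zetaOrdinate n) ^ 2) * (1 + (t - zetaOrdinate m) ^ 2))) :=
    fun n m ↦ (integrable_kernel_mul_kernel _ _).const_mul _
  rw [integral_finsetSum _ fun n _ ↦ integrable_finsetSum _ fun m _ ↦ hI n m]
  unfold montgomeryPairSum zeroIndexSet montgomeryWeight
  rw [Finset.sum_product, Finset.mul_sum]
  refine Finset.sum_congr rfl fun n _ ↦ ?_
  rw [integral_finsetSum _ fun m _ ↦ hI n m, Finset.mul_sum]
  refine Finset.sum_congr rfl fun m _ ↦ ?_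
  rw [MeasureTheory.integral_const_mul, integral_cauchyKernel_mul_cauchyKernel]
  have : (4 + (zetaOrdinate n - zetaOrdinate m) ^ 2) ≠ 0 := by positivity
  field_simp
  ring

end Montgomery

/-! ## Discharge of (P2) -/

/-- **Discharge of `Literature.NumberTheory.LFunctions.montgomery_pairSum_eq_meanSquare`** — the pair
sum as a mean square (Goldston 2005, (4.1)–(4.4), in particular (4.3):
"`F(x, T) = (2/π) ∫_0^T |∑_γ x^{iγ}/(1+(t−γ)²)|² dt + O((log T)³)`"; Montgomery 1973, §3).
Proof as printed: with `S₁` the part of Montgomery's sum over the zeros `0 < γ ≤ T`,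
(i) `∫_ℝ |S₁|² = (π/2) F(x,T)` exactly (`Montgomery.integral_norm_partial_sq`: multiply out and use
`∫ dt/((1+(t−γ)²)(1+(t−γ')²)) = (π/2) w(γ−γ')`); (ii) the tails `∫_{ℝ∖[0,T]} |S₁|² ≪ log³ T`
(`Montgomery.exists_integral_Ioi_norm_partial_sq_le`, `…_Iic_…`); (iii) on `[0, T]`,
`||S|² − |S₁|²| ≤ 3 D(t) R(t)` with `D(t) = ∑_γ 1/(1+(t−γ)²) ≪ log(|t|+2)`
(`Montgomery.exists_density_le`, from `N(t+1) − N(t) ≪ log t`, i.e. the Riemann–von Mangoldt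
formula `riemann_von_mangoldt_holds`) and `∫_0^T R ≪ log² T` (`Montgomery.exists_integral_tailSum_le`).
All constants are absolute, in particular uniform in `x > 0`. Users of the fact feed
`montgomery_pairSum_eq_meanSquare_holds` for `(h : montgomery_pairSum_eq_meanSquare)`.
[cite: Goldston2005, (4.3)] -/
theorem montgomery_pairSum_eq_meanSquare_holds : montgomery_pairSum_eq_meanSquare := by
  obtain ⟨A₁, hA₁0, hA₁⟩ := Montgomery.exists_density_le
  obtain ⟨B₂, hB₂0, hB₂⟩ := Montgomery.exists_integral_tailSum_le
  obtain ⟨B₃, hB₃0, hB₃⟩ := Montgomery.exists_integral_Ioi_norm_partial_sq_le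
  obtain ⟨B₄, hB₄0, hB₄⟩ := Montgomery.exists_integral_Iic_norm_partial_sq_le
  refine ⟨2 / π * (B₄ + B₃ + 3 * A₁ * B₂) * 8, fun x hx T hT ↦ ?_⟩
  have hT0 : (0 : ℝ) ≤ T := by linarith
  set N := zetaZeroCount T with hN
  set S₁ : ℝ → ℂ := fun t ↦ ∑ n ∈ Finset.range N,
    (x : ℂ) ^ ((zetaOrdinate n : ℂ) * I) / ((1 + (t - zetaOrdinate n) ^ 2 : ℝ) : ℂ) with hS₁
  set R : ℝ → ℝ := fun t ↦ ∑' n : ℕ, ((if n < N then 0 else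
    1 / (1 + (t - zetaOrdinate n) ^ 2)) + 1 / (1 + (t + zetaOrdinate n) ^ 2)) with hR
  set L := Real.log (T + 2) with hL
  have hL1 : 1 ≤ L := Montgomery.one_le_log_add_two hT
  have hLT : L ≤ 2 * Real.log T := by
    rw [hL, ← Real.log_rpow (by linarith), Real.rpow_two]
    exact Real.log_le_log (by linarith) (by nlinarith)
  have hlogT0 : 0 ≤ Real.log T := Real.log_nonneg (by linarith)
  -- (i) the exact identity and the splitting of `∫_ℝ |S₁|²`
  have hJ : ∫ t, ‖S₁ t‖ ^ 2 = π / 2 * montgomeryPairSum x T := Montgomery.integral_norm_partial_sq hx T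
  have hi : Integrable fun t ↦ ‖S₁ t‖ ^ 2 := Montgomery.integrable_norm_partial_sq hx T
  have hsplit : ∫ t, ‖S₁ t‖ ^ 2 = (∫ t in Iic (0 : ℝ), ‖S₁ t‖ ^ 2) +
      (∫ t in (0 : ℝ)..T, ‖S₁ t‖ ^ 2) + ∫ t in Ioi T, ‖S₁ t‖ ^ 2 := by
    have h1 := intervalIntegral.integral_Iic_add_Ioi (hi.integrableOn (s := Iic T))
      (hi.integrableOn (s := Ioi T))
    have h2 := intervalIntegral.integral_Iic_sub_Iic (hi.integrableOn (s := Iic 0))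
      (hi.integrableOn (s := Iic T))
    linarith
  -- (ii) the tails
  have hright : ∫ t in Ioi T, ‖S₁ t‖ ^ 2 ≤ B₃ * L ^ 3 := hB₃ x hx T hT
  have hleft : ∫ t in Iic (0 : ℝ), ‖S₁ t‖ ^ 2 ≤ B₄ * L ^ 2 := hB₄ x hx T hT
  have hright0 : 0 ≤ ∫ t in Ioi T, ‖S₁ t‖ ^ 2 :=
    setIntegral_nonneg measurableSet_Ioi fun t _ ↦ by positivity
  have hleft0 : 0 ≤ ∫ t in Iic (0 : ℝ), ‖S₁ t‖ ^ 2 :=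
    setIntegral_nonneg measurableSet_Iic fun t _ ↦ by positivity
  -- (iii) `∫_0^T |S|²` against `∫_0^T |S₁|²`
  obtain ⟨hRint, hRle⟩ := hB₂ T hT
  have hS_int : IntervalIntegrable (fun t ↦ ‖montgomeryZeroSum x t‖ ^ 2) volume 0 T :=
    ((Montgomery.continuous_montgomeryZeroSum hx).norm.pow 2).intervalIntegrable _ _
  have hS₁_int : IntervalIntegrable (fun t ↦ ‖S₁ t‖ ^ 2) volume 0 T :=
    ((Montgomery.continuous_partial x T).norm.pow 2).intervalIntegrable _ _
  have hmid : |(∫ t in (0 : ℝ)..T, ‖montgomeryZeroSum x t‖ ^ 2) - ∫ t in (0 : ℝ)..T, ‖S₁ t‖ ^ 2| ≤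
      3 * A₁ * L * (B₂ * L ^ 2) := by
    rw [← intervalIntegral.integral_sub hS_int hS₁_int]
    have h := intervalIntegral.norm_integral_le_of_norm_le hT0
      (f := fun t ↦ ‖montgomeryZeroSum x t‖ ^ 2 - ‖S₁ t‖ ^ 2) (g := fun t ↦ 3 * (A₁ * L) * R t)
      (ae_of_all _ fun t ht ↦ ?_) (hRint.const_mul _)
    · rw [Real.norm_eq_abs, intervalIntegral.integral_const_mul] at h
      refine h.trans ?_
      have : 3 * (A₁ * L) * ∫ t in (0 : ℝ)..T, R t ≤ 3 * (A₁ * L) * (B₂ * L ^ 2) :=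
        mul_le_mul_of_nonneg_left hRle (by nlinarith)
      linarith
    · have ht0 : 0 ≤ t := ht.1.le
      have hD := (hA₁ t).2
      rw [abs_of_nonneg ht0] at hD
      have hlogt : Real.log (t + 2) ≤ L := Real.log_le_log (by linarith) (by linarith [ht.2])
      have hR0 : 0 ≤ R t := tsum_nonneg fun n ↦ by positivity
      rw [Real.norm_eq_abs]
      calc _ ≤ 3 * (∑' n : ℕ, 1 / (1 + (t - zetaOrdinate n) ^ 2)) * R t :=
            Montgomery.abs_norm_sq_sub_norm_sq_le hx T ht0
        _ ≤ 3 * (A₁ * L) * R t := by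
            refine mul_le_mul_of_nonneg_right (mul_le_mul_of_nonneg_left ?_ (by norm_num)) hR0
            exact hD.trans (mul_le_mul_of_nonneg_left hlogt hA₁0.le)
  -- assembly
  have hF : montgomeryPairSum x T = 2 / π * ∫ t, ‖S₁ t‖ ^ 2 := by
    rw [hJ]; field_simp
  have hL2 : L ^ 2 ≤ L ^ 3 := by nlinarith
  have hL3 : L ^ 3 ≤ 8 * Real.log T ^ 3 := by
    have : L ^ 3 ≤ (2 * Real.log T) ^ 3 := by gcongr  -- needs 0 ≤ L
    linarith [this]
  rw [hF, hsplit]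
  have hπ : 0 < 2 / π := by positivity
  calc |2 / π * ((∫ t in Iic (0 : ℝ), ‖S₁ t‖ ^ 2) + (∫ t in (0 : ℝ)..T, ‖S₁ t‖ ^ 2) +
          ∫ t in Ioi T, ‖S₁ t‖ ^ 2) - 2 / π * ∫ t in (0 : ℝ)..T, ‖montgomeryZeroSum x t‖ ^ 2|
      = 2 / π * |(∫ t in Iic (0 : ℝ), ‖S₁ t‖ ^ 2) + (∫ t in Ioi T, ‖S₁ t‖ ^ 2) +
          ((∫ t in (0 : ℝ)..T, ‖S₁ t‖ ^ 2) - ∫ t in (0 : ℝ)..T, ‖montgomeryZeroSum x t‖ ^ 2)| := by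
        rw [← abs_of_pos hπ, ← abs_mul, abs_of_pos hπ]; ring_nf
    _ ≤ 2 / π * (B₄ * L ^ 2 + B₃ * L ^ 3 + 3 * A₁ * L * (B₂ * L ^ 2)) := by
        refine mul_le_mul_of_nonneg_left ?_ hπ.le
        refine (abs_add_le _ _).trans (add_le_add ?_ ?_)
        · rw [abs_of_nonneg (by positivity)]; linarith
        · rwa [abs_sub_comm]
    _ ≤ 2 / π * ((B₄ + B₃ + 3 * A₁ * B₂) * L ^ 3) := by
        refine mul_le_mul_of_nonneg_left ?_ hπ.le
        nlinarith [mul_le_mul_of_nonneg_left hL2 hB₄0.le]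
    _ ≤ 2 / π * ((B₄ + B₃ + 3 * A₁ * B₂) * (8 * Real.log T ^ 3)) := by
        refine mul_le_mul_of_nonneg_left (mul_le_mul_of_nonneg_left hL3 (by positivity)) hπ.le
    _ = 2 / π * (B₄ + B₃ + 3 * A₁ * B₂) * 8 * Real.log T ^ 3 := by ring

end Literature.NumberTheory.LFunctions

end
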